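import Literature.Analysis.FluidPDE.TorusNSBerselliGaldiCriterionLowest
import Literature.Analysis.FluidPDE.TorusNSSerrinCriterion
import Literature.Analysis.FunctionSpaces.TorusWeightedSobolevInequality
import HarnessLib

/-!
# Robinson–Sadowski's local smoothness criterion via the heat flow of the datum
# (Rend. Semin. Mat. Univ. Padova 131 (2014), Theorem 5), classical solutions on `T³`

Analysis/FluidPDE proof file (theorems only; no definitions, no named facts).
Search for candidate a priori estimates; no regularity claim.

J. C. Robinson, W. Sadowski, *A local smoothness criterion for solutions of the 3D Navier–Stokes
equations*, Rend. Semin. Mat. Univ. Padova 131 (2014) 159–178, **Theorem 5** (p. 169; `ν = 1`,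
`V = ℝ³` or `T³`): "There exists an absolute constant `ε > 0` such that if `u₀ ∈ H²` with
`∇·u₀ = 0`, and for some `T > 0`

  `‖u₀‖³_{L³} ∫₀ᵀ ∫_V |∇v(t)|² |v(t)| dx dt < ε,`                                    (16)

where `v(t)` is the solution of the heat equation with initial data `u₀`, then `u` is smooth on
`(0, T) × V`." The smallness (16) is a condition on the DATUM alone (its `L³` norm and the
weighted dissipation of its free heat evolution), and by (17),
`‖v(t)‖³_{L³} + 3∫₀ᵗ∫|∇v|²|v| ≤ ‖u₀‖³_{L³}`, it always holds for `T = T(u₀) > 0` small.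

Here the theorem is typed for CLASSICAL solutions on the unit torus `T^d`, `card d = 3`, in the
continuation form and vocabulary of the tree's other criteria (`TorusNSSerrinCriterion`,
`TorusNSSmallL3Global`), with the viscosity `ν > 0` restored by the scaling `u ↦ ν⁻¹u(·/ν)`:

* `Torus.classicalNS_continuation_of_heatFlow_criterion` — there is `ε = ε(d) > 0` such that for
  every classical mean-zero solution `(u, p)` of the unforced system on `[0, T) × T^d` and every
  jointly smooth solution `v` of `∂ₜv = νΔv` on `[0, T) × T^d` with divergence-free mean-zero slices
  and `v(0) = u(0)` (the heat flow of the datum), the bound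
  `(∫‖u(0)‖³) · ∫₀ᵗ ∫ ‖v‖ ∑ₖ‖∂ₖv‖² ≤ ε ν⁵` for all `t < T` implies that `u` continues to a
  classical mean-zero solution on some `[0, T'] × T^d`, `T' > T` (no blow-up before `T`).

The printed proof is followed step by step (split `u = v + w`, (4)–(5)):

* §5 `HeatFlowCriterion.heat_integral_norm_cube_add_dissipation_le` — the heat part (17):
  `∫‖v(t)‖³ + 3ν∫ₐᵗ∫‖v‖∑ₖ‖∂ₖv‖² ≤ ∫‖v(a)‖³`;
* §8 `HeatFlowCriterion.exists_convective_bound` — the terms `R₁ + R₂` of the `w`-balance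
  (derivatives moved onto `w|w|`, `|u|² ≤ 2|v|² + 2|w|²`, `L⁵ ⊂ [L³, L⁹]`, Hölder `(2, 18, 9/4)`,
  Lemma 2, Young);
* §9 `HeatFlowCriterion.exists_pressure_bound` — the term `R₃` (Hölder, Lemma 3 = the
  Calderón–Zygmund bound `‖p − ⟨p⟩‖_{9/4} ≤ C‖u‖²_{9/2}`, interpolation, Lemma 2, Young);
* §10 `HeatFlowCriterion.exists_deriv_remainder_le` — the differential inequality (7) with `ν`:
  `d/dt∫‖w‖³ ≤ −(5/2)νX_w + K₁ν⁻¹(∫‖w‖³)^{2/3}X_w + K₂(∫‖w‖³)^{1/3}X_w + K₃ν⁻²(∫‖v‖³)X_v`,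
  `X_z = ∫‖z‖∑ₖ‖∂ₖz‖² = ∫|∇z|²|z|`;
* §11 `HeatFlowCriterion.lt_of_deriv_le_forcing_below` — Lemma 4 as a first-hitting-time
  (trapping) argument;
* §12 the theorem: trapping keeps `∫‖w‖³ < mν³`, whence `2ν∫₀ᵗX_w ≤ K₃ν⁻²‖u₀‖³_{L³}∫₀ᵗX_v`,
  Lemma 2 converts `∫₀ᵗ(X_v + X_w)` into a bound on `∫₀ᵗ‖u‖³_{L⁹}` — Serrin's class
  `L³(0,T;L⁹)`, `2/3 + 3/9 = 1` — and the tree's Serrin continuation applies.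

The two facts about the exact weight `‖w‖` that the printed computation uses implicitly —
the transport identity `∫‖w‖⟪(w·∇)w, w⟫ = 0` and the integration by parts
`|∫‖w‖⟪w,(u·∇)u⟫| ≤ 2∫|u|²|w||∇w|` (`|∇(w|w|)| ≤ 2|w||∇w|`) — are proved in §2 through the
smooth test fields `(‖w‖² + ε)^{1/2}w` and `ε ↓ 0` (continuity of the parametric integrals).

Deviations from print (faithfulness): classical solutions with mean-zero slices on the unit torus
(print: `u₀ ∈ H²`, then Theorem 6 relaxes to `u₀ ∈ L³ ∩ L²` by approximation — not restated);
the heat flow enters as a universally quantified smooth solution `v` of the heat equation with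
the listed (true) properties of `e^{νtΔ}u(0)` instead of the semigroup itself; the smallness is
placed on the primitive `t ↦ ∫₀ᵗ X_v` on `[0, T)`; `ε = ε(d)` is existential (print: absolute,
inexplicit); "smooth on `(0, T)`" is rendered as continuation past `T` (iterate from local
existence). Constants are not tracked. Nothing here is a regularity claim beyond the printed
conditional criterion.

These serve the functional-mining cell (pub-nsfunc): CRITERIA (a criterion of a new type — in
terms of the free evolution of the datum; it yields a rigorous lower bound on the blow-up time of
the bank's candidate flows: no singularity before the first `T` with
`‖u₀‖³_{L³}∫₀ᵀ∫|∇e^{νtΔ}u₀|²|e^{νtΔ}u₀| = εν⁵`) and the `L³`/`L⁹` bookkeeping of §B.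

## Mathlib / tree search

Tree (used): `Torus.IsClassicalNSSolutionOn.deriv_integral_normSq_rpow_le_of_two_le`
(`TorusVelocityRealMomentBalance`, RRS (11.19)), `integral_deriv_comp_normSq_mul_inner_convect_eq_zero`
(`TorusVelocityMomentBalance`), `Torus.integral_inner_convect_eq_neg` (`TorusFluidGlueProofs`),
`Torus.exists_rpow_integral_norm_rpow_le_weighted` (`TorusWeightedSobolevInequality`, Lemma 2),
`Torus.exists_pressure_sub_average_Ls_le_normSq` (`TorusNSBerselliGaldiCriterionLowest`, Lemma 3),
`Torus.classicalNS_continuation_of_Ls_rpow_integral_le` (`TorusNSSerrinCriterion`),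
`Torus.IsSmooth.comp_of_contDiffOn` / `Torus.partialDeriv_comp_of_contDiffOn`
(`TorusLowOrderLeibniz`), `Torus.hasDerivWithinAt_integral_of_convex`,
`Torus.continuousOn_integral_of_continuousOn_stLift`; Mathlib
`Real.geom_mean_le_arith_mean2_weighted`, `NNReal.rpow_add_le_mul_rpow_add_rpow`,
`NNReal.rpow_add_le_add_rpow`, `integral_mul_le_Lp_mul_Lq_of_nonneg`,
`continuous_parametric_integral_of_continuous`, `antitoneOn_of_hasDerivWithinAt_nonpos`,
`IsClosed.csInf_mem`. Searched (`lean search`): `heatFlow.*criterion|HeatFlowCriterion|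
classicalNS_continuation_of_heatFlow` — nothing; the tree has Theorem 6 (ii)
(`TorusNSSmallL3Global`), Theorem 8 / Cor 9 (`TorusNSLebesgueNormGrowthRate`), Cor 10
(`TorusNSSobolevBlowupRate`) and Lemma 2 of the same paper, not Theorem 5.

## References

* J. C. Robinson, W. Sadowski, *A local smoothness criterion for solutions of the 3D Navier–Stokes
  equations*, Rend. Semin. Mat. Univ. Padova 131 (2014) 159–178, doi:10.4171/rsmup/131-9:
  Theorem 5 (pp. 169–171), eqs. (2)–(7) (pp. 160–162), (16)–(17) (p. 169), Lemma 2 (p. 164),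
  Lemmas 3–4 (p. 167) (held: paper:doi-10-4171-rsmup-131-9). [RobinsonSadowski2014]
* J. C. Robinson, J. L. Rodrigo, W. Sadowski, *The Three-Dimensional Navier–Stokes Equations*,
  CUP 2016, Exercises 11.1–11.4 (the `L^α` balance (11.19)), Thm 8.17 (Serrin).
  [RobinsonRodrigoSadowski2016]
-/

noncomputable section

open MeasureTheory Finset Set Filter Topology
open scoped InnerProductSpace RealInnerProductSpace ContDiff

namespace Literature.Analysis.FluidPDE

open Literature.Analysis.FunctionSpaces

variable {d : Type*} [Fintype d] [DecidableEq d]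

namespace HeatFlowCriterion

/-! ## 1. Helpers -/

/-- Shifting the pressure by a constant gives again a classical solution (same velocity, same
force): `∇(p − c) = ∇p` (as in `TorusNSSmallL3Global`). [folklore] -/
private theorem pressure_sub_const {S : Set ℝ} {ν : ℝ}
    {f u : ℝ → UnitAddTorus d → EuclideanSpace ℝ d} {p : ℝ → UnitAddTorus d → ℝ}
    (h : Torus.IsClassicalNSSolutionOn S ν f u p) (c : ℝ) :
    Torus.IsClassicalNSSolutionOn S ν f u (fun t x => p t x - c) where
  smooth_velocity := h.smooth_velocity
  smooth_pressure :=
    h.smooth_pressure.sub (Torus.isSmoothSpaceTimeOn_const (Torus.isSmooth_const c) S)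
  momentum t ht x := by
    rw [Torus.gradient_sub_const_apply]
    exact h.momentum t ht x
  divFree := h.divFree

omit [DecidableEq d] in
/-- Hölder on `T^d` with weights `a + b = 1` for continuous non-negative `f, g`:
`∫ f g ≤ (∫ f^{1/a})^a (∫ g^{1/b})^b` (as in `TorusNSSmallL3Global`). [folklore] -/
private theorem integral_mul_le_rpow_mul_rpow {f g : UnitAddTorus d → ℝ} (hf : Continuous f)
    (hg : Continuous g) (hf0 : ∀ x, 0 ≤ f x) (hg0 : ∀ x, 0 ≤ g x) {a b : ℝ} (ha : 0 < a)
    (hb : 0 < b) (hab : a + b = 1) :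
    ∫ x, f x * g x ≤ (∫ x, f x ^ a⁻¹) ^ a * (∫ x, g x ^ b⁻¹) ^ b := by
  have hpq : (a⁻¹).HolderConjugate b⁻¹ := Real.HolderConjugate.inv_inv ha hb hab
  have h := integral_mul_le_Lp_mul_Lq_of_nonneg (μ := volume) hpq (ae_of_all _ hf0)
    (ae_of_all _ hg0) (hf.memLp_of_hasCompactSupport (HasCompactSupport.of_compactSpace f))
    (hg.memLp_of_hasCompactSupport (HasCompactSupport.of_compactSpace g))
  simpa only [one_div, inv_inv] using h

omit [DecidableEq d] in
/-- Lyapunov's interpolation of Lebesgue norms on `T^d` for a continuous `w`: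
`∫ ‖w‖^r ≤ (∫ ‖w‖^p)^a (∫ ‖w‖^q)^b` whenever `a, b > 0`, `a + b = 1`, `r = a p + b q`
(Hölder with `f = ‖w‖^{ap}`, `g = ‖w‖^{bq}`). [folklore] -/
private theorem integral_norm_rpow_le_interpolate {E : Type*} [NormedAddCommGroup E]
    {w : UnitAddTorus d → E} (hw : Continuous w) {p q r a b : ℝ} (hp : 0 < p) (hq : 0 < q)
    (ha : 0 < a) (hb : 0 < b) (hab : a + b = 1) (hr : r = a * p + b * q) :
    ∫ x, ‖w x‖ ^ r ≤ (∫ x, ‖w x‖ ^ p) ^ a * (∫ x, ‖w x‖ ^ q) ^ b := by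
  have hH := integral_mul_le_rpow_mul_rpow (f := fun x => ‖w x‖ ^ (a * p))
    (g := fun x => ‖w x‖ ^ (b * q)) (hw.norm.rpow_const fun x => Or.inr (by positivity))
    (hw.norm.rpow_const fun x => Or.inr (by positivity)) (fun x => Real.rpow_nonneg (norm_nonneg _) _)
    (fun x => Real.rpow_nonneg (norm_nonneg _) _) ha hb hab
  have e0 : ∀ x, ‖w x‖ ^ (a * p) * ‖w x‖ ^ (b * q) = ‖w x‖ ^ r := by
    intro x
    rw [hr, Real.rpow_add' (norm_nonneg _) (by positivity)]
  have e1 : ∀ x, (‖w x‖ ^ (a * p)) ^ a⁻¹ = ‖w x‖ ^ p := by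
    intro x
    rw [← Real.rpow_mul (norm_nonneg _), mul_comm a p, mul_assoc, mul_inv_cancel₀ ha.ne', mul_one]
  have e2 : ∀ x, (‖w x‖ ^ (b * q)) ^ b⁻¹ = ‖w x‖ ^ q := by
    intro x
    rw [← Real.rpow_mul (norm_nonneg _), mul_comm b q, mul_assoc, mul_inv_cancel₀ hb.ne', mul_one]
  simp only [e0, e1, e2] at hH
  exact hH

omit [DecidableEq d] in
/-- Continuity of `ε ↦ ∫_{T^d} F(ε, x) dx` for jointly continuous `F` (as in
`TorusWeightedSobolevInequality`). [folklore] -/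
private theorem continuous_integral_param {E' : Type*} [NormedAddCommGroup E']
    [NormedSpace ℝ E'] {F : ℝ → UnitAddTorus d → E'} (hF : Continuous (Function.uncurry F)) :
    Continuous fun ε => ∫ x, F ε x := by
  have h := continuous_parametric_integral_of_continuous (μ := volume) hF isCompact_univ
  simpa only [Measure.restrict_univ] using h

omit [DecidableEq d] in
/-- A continuous real function on `[0, ∞)`-germs: if `F` is continuous and `F ε = G ε` for all
`ε > 0` with `G` continuous, then `F 0 = G 0` (limits from the right). [folklore] -/
private theorem eq_of_forall_pos_eq {F G : ℝ → ℝ} (hF : Continuous F) (hG : Continuous G)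
    (h : ∀ ε, 0 < ε → F ε = G ε) : F 0 = G 0 := by
  have h1 : Tendsto F (𝓝[>] 0) (𝓝 (F 0)) := hF.continuousAt.continuousWithinAt.tendsto
  have h2 : Tendsto G (𝓝[>] 0) (𝓝 (G 0)) := hG.continuousAt.continuousWithinAt.tendsto
  have h3 : F =ᶠ[𝓝[>] 0] G :=
    eventually_nhdsWithin_of_forall fun ε hε => h ε hε
  exact tendsto_nhds_unique (h1.congr' h3) h2

omit [DecidableEq d] in
/-- If `F ε ≤ G ε` for all `ε > 0` with `F, G` continuous, then `F 0 ≤ G 0`. [folklore] -/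
private theorem le_of_forall_pos_le {F G : ℝ → ℝ} (hF : Continuous F) (hG : Continuous G)
    (h : ∀ ε, 0 < ε → F ε ≤ G ε) : F 0 ≤ G 0 := by
  have h1 : Tendsto F (𝓝[>] 0) (𝓝 (F 0)) := hF.continuousAt.continuousWithinAt.tendsto
  have h2 : Tendsto G (𝓝[>] 0) (𝓝 (G 0)) := hG.continuousAt.continuousWithinAt.tendsto
  haveI : (𝓝[>] (0 : ℝ)).NeBot := nhdsGT_neBot 0
  exact le_of_tendsto_of_tendsto h1 h2 (eventually_nhdsWithin_of_forall fun ε hε => h ε hε)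

/-! ## 2. The regularised weight `(‖w‖² + ε)^{1/2}` and two static facts about the exact weight `‖w‖` -/

omit [DecidableEq d] in
/-- The radial weight `(‖w‖² + ε)^r` is smooth for `ε > 0` (as in
`TorusWeightedSobolevInequality`). [folklore] -/
private theorem isSmooth_rpow_normSq_add {w : UnitAddTorus d → EuclideanSpace ℝ d}
    (hw : Torus.IsSmooth w) {ε : ℝ} (hε : 0 < ε) (r : ℝ) :
    Torus.IsSmooth (fun x => (‖w x‖ ^ 2 + ε) ^ r) := by
  have h1 : Torus.IsSmooth (fun x => ‖w x‖ ^ 2 + ε) :=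
    (hw.norm_sq).add (Torus.isSmooth_const (d := d) (c := ε))
  have hφ : ContDiffOn ℝ ∞ (fun t : ℝ => t ^ r) (Set.Ioi 0) := fun y hy =>
    (Real.contDiffAt_rpow_const_of_ne (p := r) (ne_of_gt hy)).contDiffWithinAt
  exact Torus.IsSmooth.comp_of_contDiffOn hφ h1 fun x => by
    show 0 < ‖w x‖ ^ 2 + ε
    positivity

/-- `∂ₖ(‖w‖² + ε) = 2⟪w, ∂ₖw⟫`. [folklore] -/
private theorem partialDeriv_normSq_add {w : UnitAddTorus d → EuclideanSpace ℝ d}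
    (hw : Torus.IsSmooth w) (ε : ℝ) (k : d) (x : UnitAddTorus d) :
    Torus.partialDeriv k (fun y => ‖w y‖ ^ 2 + ε) x = 2 * ⟪w x, Torus.partialDeriv k w x⟫ := by
  have hw1 : Torus.IsContDiff 1 w := hw.isContDiff (by simp)
  have e : (fun y => ‖w y‖ ^ 2 + ε) = (fun y => ⟪w y, w y⟫) + fun _ => ε := by
    funext y; simp only [Pi.add_apply, real_inner_self_eq_norm_sq]
  have hcst : Torus.IsContDiff 1 (fun _ : UnitAddTorus d => ε) := contDiff_const
  have hinn : Torus.IsContDiff 1 (fun y => ⟪w y, w y⟫) := ContDiff.inner ℝ hw1 hw1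
  have hc0 : Torus.partialDeriv k (fun _ : UnitAddTorus d => ε) x = 0 := by
    simp [Torus.partialDeriv, Torus.lineDeriv]
  rw [e, Torus.partialDeriv_add hinn hcst, Pi.add_apply, Torus.partialDeriv_inner hw1 hw1, hc0,
    add_zero, real_inner_comm (Torus.partialDeriv k w x) (w x)]
  ring

/-- `∂ₖ(‖w‖² + ε)^{1/2} = ⟪w, ∂ₖw⟫ (‖w‖² + ε)^{−1/2}` for `ε > 0`, as the bound
`|∂ₖ(‖w‖² + ε)^{1/2}| · ‖w‖ ≤ (‖w‖² + ε)^{1/2} ‖∂ₖw‖`. [folklore] -/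
private theorem abs_partialDeriv_sqrtWeight_mul_norm_le {w : UnitAddTorus d → EuclideanSpace ℝ d}
    (hw : Torus.IsSmooth w) {ε : ℝ} (hε : 0 < ε) (k : d) (x : UnitAddTorus d) :
    |Torus.partialDeriv k (fun y => (‖w y‖ ^ 2 + ε) ^ (1 / 2 : ℝ)) x| * ‖w x‖ ≤
      (‖w x‖ ^ 2 + ε) ^ (1 / 2 : ℝ) * ‖Torus.partialDeriv k w x‖ := by
  have h1 : Torus.IsSmooth (fun y => ‖w y‖ ^ 2 + ε) :=
    (hw.norm_sq).add (Torus.isSmooth_const (d := d) (c := ε))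
  have hpos : ∀ y, 0 < ‖w y‖ ^ 2 + ε := fun y => by positivity
  have hφ : ContDiffOn ℝ ∞ (fun t : ℝ => t ^ (1 / 2 : ℝ)) (Set.Ioi 0) := fun y hy =>
    (Real.contDiffAt_rpow_const_of_ne (p := 1 / 2) (ne_of_gt hy)).contDiffWithinAt
  have h := Torus.partialDeriv_comp_of_contDiffOn hφ isOpen_Ioi h1 (fun y => hpos y) k x
  have hderiv : deriv (fun t : ℝ => t ^ (1 / 2 : ℝ)) (‖w x‖ ^ 2 + ε) =
      (1 / 2) * (‖w x‖ ^ 2 + ε) ^ ((1 / 2 : ℝ) - 1) :=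
    (Real.hasDerivAt_rpow_const (p := 1 / 2) (Or.inl (hpos x).ne')).deriv
  change |Torus.partialDeriv k (fun z => (fun t : ℝ => t ^ (1 / 2 : ℝ)) ((fun y => ‖w y‖ ^ 2 + ε) z)) x|
      * ‖w x‖ ≤ _
  rw [h, hderiv, partialDeriv_normSq_add hw ε k x]
  set h0 : ℝ := ‖w x‖ ^ 2 + ε with hh0
  have hh0pos : 0 < h0 := hpos x
  -- `(1/2) h^{-1/2} (2⟪w,∂w⟫) = ⟪w,∂w⟫ h^{-1/2}`
  have e1 : (1 / 2 : ℝ) * h0 ^ ((1 / 2 : ℝ) - 1) * (2 * ⟪w x, Torus.partialDeriv k w x⟫) =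
      h0 ^ ((1 / 2 : ℝ) - 1) * ⟪w x, Torus.partialDeriv k w x⟫ := by ring
  rw [e1, abs_mul, abs_of_nonneg (Real.rpow_nonneg hh0pos.le _)]
  have hcs : |⟪w x, Torus.partialDeriv k w x⟫| ≤ ‖w x‖ * ‖Torus.partialDeriv k w x‖ :=
    abs_real_inner_le_norm _ _
  -- `h^{-1/2} ‖w‖² ≤ h^{1/2}`
  have hkey : h0 ^ ((1 / 2 : ℝ) - 1) * ‖w x‖ ^ 2 ≤ h0 ^ (1 / 2 : ℝ) := by
    have hw2 : ‖w x‖ ^ 2 ≤ h0 := by rw [hh0]; linarith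
    calc h0 ^ ((1 / 2 : ℝ) - 1) * ‖w x‖ ^ 2 ≤ h0 ^ ((1 / 2 : ℝ) - 1) * h0 :=
          mul_le_mul_of_nonneg_left hw2 (Real.rpow_nonneg hh0pos.le _)
      _ = h0 ^ (1 / 2 : ℝ) := by
          calc h0 ^ ((1 / 2 : ℝ) - 1) * h0 = h0 ^ ((1 / 2 : ℝ) - 1) * h0 ^ (1 : ℝ) := by
                rw [Real.rpow_one]
            _ = h0 ^ (1 / 2 : ℝ) := by rw [← Real.rpow_add hh0pos]; norm_num
  calc h0 ^ ((1 / 2 : ℝ) - 1) * |⟪w x, Torus.partialDeriv k w x⟫| * ‖w x‖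
      ≤ h0 ^ ((1 / 2 : ℝ) - 1) * (‖w x‖ * ‖Torus.partialDeriv k w x‖) * ‖w x‖ := by
        gcongr
    _ = h0 ^ ((1 / 2 : ℝ) - 1) * ‖w x‖ ^ 2 * ‖Torus.partialDeriv k w x‖ := by ring
    _ ≤ h0 ^ (1 / 2 : ℝ) * ‖Torus.partialDeriv k w x‖ :=
        mul_le_mul_of_nonneg_right hkey (norm_nonneg _)

/-- Derivative bound for the regularised test field `φ_ε = (‖w‖² + ε)^{1/2} w`:
`‖∂ₖφ_ε‖ ≤ 2 (‖w‖² + ε)^{1/2} ‖∂ₖw‖`. [folklore] -/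
private theorem norm_partialDeriv_sqrtWeight_smul_le {w : UnitAddTorus d → EuclideanSpace ℝ d}
    (hw : Torus.IsSmooth w) {ε : ℝ} (hε : 0 < ε) (k : d) (x : UnitAddTorus d) :
    ‖Torus.partialDeriv k (fun y => (‖w y‖ ^ 2 + ε) ^ (1 / 2 : ℝ) • w y) x‖ ≤
      2 * (‖w x‖ ^ 2 + ε) ^ (1 / 2 : ℝ) * ‖Torus.partialDeriv k w x‖ := by
  have hθ : Torus.IsContDiff 1 (fun y => (‖w y‖ ^ 2 + ε) ^ (1 / 2 : ℝ)) :=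
    (isSmooth_rpow_normSq_add hw hε (1 / 2)).isContDiff (by simp)
  have hw1 : Torus.IsContDiff 1 w := hw.isContDiff (by simp)
  rw [Torus.partialDeriv_smul hθ hw1]
  have hb := abs_partialDeriv_sqrtWeight_mul_norm_le hw hε k x
  have hpos : 0 < ‖w x‖ ^ 2 + ε := by positivity
  have h1 : ‖(‖w x‖ ^ 2 + ε) ^ (1 / 2 : ℝ) • Torus.partialDeriv k w x‖ =
      (‖w x‖ ^ 2 + ε) ^ (1 / 2 : ℝ) * ‖Torus.partialDeriv k w x‖ := by
    rw [norm_smul, Real.norm_of_nonneg (Real.rpow_nonneg hpos.le _)]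
  have h2 : ‖Torus.partialDeriv k (fun y => (‖w y‖ ^ 2 + ε) ^ (1 / 2 : ℝ)) x • w x‖ ≤
      (‖w x‖ ^ 2 + ε) ^ (1 / 2 : ℝ) * ‖Torus.partialDeriv k w x‖ := by
    rw [norm_smul, Real.norm_eq_abs]; exact hb
  calc ‖(‖w x‖ ^ 2 + ε) ^ (1 / 2 : ℝ) • Torus.partialDeriv k w x +
        Torus.partialDeriv k (fun y => (‖w y‖ ^ 2 + ε) ^ (1 / 2 : ℝ)) x • w x‖
      ≤ ‖(‖w x‖ ^ 2 + ε) ^ (1 / 2 : ℝ) • Torus.partialDeriv k w x‖ +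
          ‖Torus.partialDeriv k (fun y => (‖w y‖ ^ 2 + ε) ^ (1 / 2 : ℝ)) x • w x‖ := norm_add_le _ _
    _ ≤ (‖w x‖ ^ 2 + ε) ^ (1 / 2 : ℝ) * ‖Torus.partialDeriv k w x‖ +
          (‖w x‖ ^ 2 + ε) ^ (1 / 2 : ℝ) * ‖Torus.partialDeriv k w x‖ := by rw [h1]; gcongr
    _ = 2 * (‖w x‖ ^ 2 + ε) ^ (1 / 2 : ℝ) * ‖Torus.partialDeriv k w x‖ := by ring

omit [DecidableEq d] in
/-- Cauchy–Schwarz in `ℝ^d`: `∑ₖ |uₖ| aₖ ≤ ‖u‖ (∑ₖ aₖ²)^{1/2}`. [folklore] -/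
private theorem sum_abs_mul_le_norm_mul_sqrt (u : EuclideanSpace ℝ d) (a : d → ℝ) :
    ∑ k, |u k| * a k ≤ ‖u‖ * Real.sqrt (∑ k, a k ^ 2) := by
  have h := Real.sum_mul_le_sqrt_mul_sqrt Finset.univ (fun k => |u k|) a
  have e : Real.sqrt (∑ k, |u k| ^ 2) = ‖u‖ := by
    rw [EuclideanSpace.norm_eq]
    simp only [Real.norm_eq_abs, sq_abs]
  rw [e] at h
  exact h

/-- Pointwise bound for the convective derivative of the regularised test field along `u`:
`‖(u·∇)φ_ε‖ ≤ 2 (‖w‖² + ε)^{1/2} ‖u‖ (∑ₖ‖∂ₖw‖²)^{1/2}`. [folklore] -/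
private theorem norm_convect_sqrtWeight_smul_le {u w : UnitAddTorus d → EuclideanSpace ℝ d}
    (hw : Torus.IsSmooth w) {ε : ℝ} (hε : 0 < ε) (x : UnitAddTorus d) :
    ‖Torus.convect u (fun y => (‖w y‖ ^ 2 + ε) ^ (1 / 2 : ℝ) • w y) x‖ ≤
      2 * (‖w x‖ ^ 2 + ε) ^ (1 / 2 : ℝ) * ‖u x‖ *
        Real.sqrt (∑ k, ‖Torus.partialDeriv k w x‖ ^ 2) := by
  set φ : UnitAddTorus d → EuclideanSpace ℝ d := fun y => (‖w y‖ ^ 2 + ε) ^ (1 / 2 : ℝ) • w y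
    with hφ
  have hφs : Torus.IsSmooth φ := (isSmooth_rpow_normSq_add hw hε (1 / 2)).smul' hw
  have hpos : 0 < ‖w x‖ ^ 2 + ε := by positivity
  set ρ : ℝ := (‖w x‖ ^ 2 + ε) ^ (1 / 2 : ℝ) with hρ
  have hρ0 : 0 ≤ ρ := Real.rpow_nonneg hpos.le _
  unfold Torus.convect
  rw [Torus.fderiv_apply_eq_sum_partialDeriv (hφs.isContDiff (by simp))]
  calc ‖∑ i, u x i • Torus.partialDeriv i φ x‖
      ≤ ∑ i, ‖u x i • Torus.partialDeriv i φ x‖ := norm_sum_le _ _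
    _ = ∑ i, |u x i| * ‖Torus.partialDeriv i φ x‖ :=
        Finset.sum_congr rfl fun i _ => by rw [norm_smul, Real.norm_eq_abs]
    _ ≤ ∑ i, |u x i| * (2 * ρ * ‖Torus.partialDeriv i w x‖) :=
        Finset.sum_le_sum fun i _ => mul_le_mul_of_nonneg_left
          (norm_partialDeriv_sqrtWeight_smul_le hw hε i x) (abs_nonneg _)
    _ = 2 * ρ * ∑ i, |u x i| * ‖Torus.partialDeriv i w x‖ := by
        rw [Finset.mul_sum]
        exact Finset.sum_congr rfl fun i _ => by ring
    _ ≤ 2 * ρ * (‖u x‖ * Real.sqrt (∑ k, ‖Torus.partialDeriv k w x‖ ^ 2)) :=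
        mul_le_mul_of_nonneg_left (sum_abs_mul_le_norm_mul_sqrt (u x) _) (by positivity)
    _ = 2 * ρ * ‖u x‖ * Real.sqrt (∑ k, ‖Torus.partialDeriv k w x‖ ^ 2) := by ring

/-- **Transport identity for the exact weight `‖z‖`** (Robinson–Rodrigo–Sadowski 2016, Exercise
11.3 at `α = 1`): for a smooth divergence-free `z` on `T^d`, `∫ ‖z‖ ⟪(z·∇)z, z⟫ = 0`. Proved
through the smooth weights `(‖z‖² + ε)^{1/2}` (`integral_deriv_comp_normSq_mul_inner_convect_eq_zero`
with `g(s) = (2/3)(s + ε)^{3/2}`) and `ε ↓ 0`. [cite: RobinsonRodrigoSadowski2016, Ch. 11 Exercise 11.3] -/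
theorem integral_norm_mul_inner_convect_self_eq_zero {z : UnitAddTorus d → EuclideanSpace ℝ d}
    (hz : Torus.IsSmooth z) (hdiv : Torus.IsDivFree z) :
    ∫ x, (‖z x‖ ^ 2) ^ (1 / 2 : ℝ) * ⟪z x, Torus.convect z z x⟫ = 0 := by
  -- the ε-family `F ε = ∫ (‖z‖² + ε)^{1/2} ⟪z, (z·∇)z⟫`, continuous in `ε`
  set F : ℝ → ℝ := fun ε => ∫ x, (‖z x‖ ^ 2 + ε) ^ (1 / 2 : ℝ) * ⟪z x, Torus.convect z z x⟫
    with hFdef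
  have hzc : Continuous z := hz.continuous
  have hcc : Continuous (Torus.convect z z) := (hz.convect hz).continuous
  have hFc : Continuous F := by
    refine continuous_integral_param ?_
    refine Continuous.mul ?_ ?_
    · refine Continuous.rpow_const ?_ fun q => Or.inr (by norm_num)
      exact ((hzc.comp continuous_snd).norm.pow 2).add continuous_fst
    · exact (hzc.comp continuous_snd).inner (hcc.comp continuous_snd)
  have hGc : Continuous (fun _ : ℝ => (0 : ℝ)) := continuous_const
  have hval : ∀ ε, 0 < ε → F ε = 0 := by
    intro ε hε
    have hU : IsOpen (Set.Ioi (-ε)) := isOpen_Ioi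
    have hg : ContDiffOn ℝ ∞ (fun s : ℝ => (2 / 3 : ℝ) * (s + ε) ^ (3 / 2 : ℝ)) (Set.Ioi (-ε)) := by
      intro s hs
      have hs1 : -ε < s := hs
      have hs' : s + ε ≠ 0 := (by linarith : 0 < s + ε).ne'
      exact (contDiffAt_const.mul
        ((contDiffAt_id.add contDiffAt_const).rpow_const_of_ne hs')).contDiffWithinAt
    have hmaps : ∀ x, ‖z x‖ ^ 2 ∈ Set.Ioi (-ε) := fun x => by
      show -ε < ‖z x‖ ^ 2
      nlinarith [sq_nonneg ‖z x‖]
    have h0 := integral_deriv_comp_normSq_mul_inner_convect_eq_zero hz hdiv hU hg hmaps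
    have hder : ∀ x, deriv (fun s : ℝ => (2 / 3 : ℝ) * (s + ε) ^ (3 / 2 : ℝ)) (‖z x‖ ^ 2) =
        (‖z x‖ ^ 2 + ε) ^ (1 / 2 : ℝ) := by
      intro x
      have hpos : 0 < ‖z x‖ ^ 2 + ε := by positivity
      have h1 : HasDerivAt (fun s : ℝ => (s + ε) ^ (3 / 2 : ℝ))
          (1 * (3 / 2 : ℝ) * (‖z x‖ ^ 2 + ε) ^ ((3 / 2 : ℝ) - 1)) (‖z x‖ ^ 2) :=
        ((hasDerivAt_id _).add_const ε).rpow_const (p := 3 / 2) (Or.inl hpos.ne')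
      have h2 := h1.const_mul (2 / 3 : ℝ)
      rw [h2.deriv]
      norm_num
      ring
    simp_rw [hder] at h0
    rw [hFdef]
    simp only
    rw [← h0]
    refine integral_congr_ae (ae_of_all _ fun x => ?_)
    show (‖z x‖ ^ 2 + ε) ^ (1 / 2 : ℝ) * ⟪z x, Torus.convect z z x⟫ =
      (‖z x‖ ^ 2 + ε) ^ (1 / 2 : ℝ) * ⟪Torus.convect z z x, z x⟫
    rw [real_inner_comm]
  have h := eq_of_forall_pos_eq hFc hGc hval
  simpa [hFdef] using h

/-- **The convective term against `‖w‖ w`, derivatives moved onto `w`** (Robinson–Sadowski 2014,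
proof of Theorem 5, the terms `R₁ + R₂`: `−∫[(u·∇)u]·w|w| = ∫ uᵢuⱼ ∂ᵢ(wⱼ|w|) ≤ c∫|u|²|∇w||w|`).
For smooth `u, w` on `T^d` with `div u = 0`:
`|∫ ‖w‖ ⟪w, (u·∇)u⟫| ≤ 2 ∫ ‖u‖² ‖w‖ (∑ₖ‖∂ₖw‖²)^{1/2}`, via the antisymmetry
`∫⟪(u·∇)u, φ⟫ = −∫⟪u, (u·∇)φ⟫` for the smooth test fields `φ_ε = (‖w‖² + ε)^{1/2} w` and `ε ↓ 0`.
[cite: RobinsonSadowski2014, Theorem 5 (proof, p. 170)] -/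
theorem abs_integral_norm_mul_inner_convect_le {u w : UnitAddTorus d → EuclideanSpace ℝ d}
    (hu : Torus.IsSmooth u) (hdiv : Torus.IsDivFree u) (hw : Torus.IsSmooth w) :
    |∫ x, (‖w x‖ ^ 2) ^ (1 / 2 : ℝ) * ⟪w x, Torus.convect u u x⟫| ≤
      2 * ∫ x, ‖u x‖ ^ 2 * ((‖w x‖ ^ 2) ^ (1 / 2 : ℝ) *
        Real.sqrt (∑ k, ‖Torus.partialDeriv k w x‖ ^ 2)) := by
  set F : ℝ → ℝ := fun ε => |∫ x, (‖w x‖ ^ 2 + ε) ^ (1 / 2 : ℝ) * ⟪w x, Torus.convect u u x⟫|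
    with hFdef
  set G : ℝ → ℝ := fun ε => 2 * ∫ x, ‖u x‖ ^ 2 * ((‖w x‖ ^ 2 + ε) ^ (1 / 2 : ℝ) *
    Real.sqrt (∑ k, ‖Torus.partialDeriv k w x‖ ^ 2)) with hGdef
  have huc : Continuous u := hu.continuous
  have hwc : Continuous w := hw.continuous
  have hcc : Continuous (Torus.convect u u) := (hu.convect hu).continuous
  have hGw : Continuous fun x => Real.sqrt (∑ k, ‖Torus.partialDeriv k w x‖ ^ 2) :=
    (continuous_finsetSum _ fun k _ => (hw.partialDeriv k).continuous.norm.pow 2).sqrt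
  have hρc : Continuous fun q : ℝ × UnitAddTorus d => (‖w q.2‖ ^ 2 + q.1) ^ (1 / 2 : ℝ) := by
    refine Continuous.rpow_const ?_ fun q => Or.inr (by norm_num)
    exact ((hwc.comp continuous_snd).norm.pow 2).add continuous_fst
  have hFc : Continuous F := by
    refine (continuous_integral_param ?_).abs
    exact hρc.mul ((hwc.comp continuous_snd).inner (hcc.comp continuous_snd))
  have hGc : Continuous G := by
    refine continuous_const.mul (continuous_integral_param ?_)
    exact ((huc.comp continuous_snd).norm.pow 2).mul (hρc.mul (hGw.comp continuous_snd))
  have hval : ∀ ε, 0 < ε → F ε ≤ G ε := by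
    intro ε hε
    set φ : UnitAddTorus d → EuclideanSpace ℝ d := fun y => (‖w y‖ ^ 2 + ε) ^ (1 / 2 : ℝ) • w y
      with hφ
    have hφs : Torus.IsSmooth φ := (isSmooth_rpow_normSq_add hw hε (1 / 2)).smul' hw
    -- antisymmetry of `(u·∇)` for divergence-free `u`
    have hanti := Torus.integral_inner_convect_eq_neg hu hdiv hu hφs
    have e1 : (∫ x, (‖w x‖ ^ 2 + ε) ^ (1 / 2 : ℝ) * ⟪w x, Torus.convect u u x⟫) =
        ∫ x, ⟪Torus.convect u u x, φ x⟫ := by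
      refine integral_congr_ae (ae_of_all _ fun x => ?_)
      show (‖w x‖ ^ 2 + ε) ^ (1 / 2 : ℝ) * ⟪w x, Torus.convect u u x⟫ =
        ⟪Torus.convect u u x, (‖w x‖ ^ 2 + ε) ^ (1 / 2 : ℝ) • w x⟫
      rw [real_inner_smul_right, real_inner_comm]
    have hbound : ∀ x, |⟪u x, Torus.convect u φ x⟫| ≤
        2 * (‖u x‖ ^ 2 * ((‖w x‖ ^ 2 + ε) ^ (1 / 2 : ℝ) *
          Real.sqrt (∑ k, ‖Torus.partialDeriv k w x‖ ^ 2))) := by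
      intro x
      have h1 := abs_real_inner_le_norm (u x) (Torus.convect u φ x)
      have h2 := norm_convect_sqrtWeight_smul_le (u := u) hw hε x
      calc |⟪u x, Torus.convect u φ x⟫| ≤ ‖u x‖ * ‖Torus.convect u φ x‖ := h1
        _ ≤ ‖u x‖ * (2 * (‖w x‖ ^ 2 + ε) ^ (1 / 2 : ℝ) * ‖u x‖ *
              Real.sqrt (∑ k, ‖Torus.partialDeriv k w x‖ ^ 2)) :=
            mul_le_mul_of_nonneg_left h2 (norm_nonneg _)
        _ = 2 * (‖u x‖ ^ 2 * ((‖w x‖ ^ 2 + ε) ^ (1 / 2 : ℝ) *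
              Real.sqrt (∑ k, ‖Torus.partialDeriv k w x‖ ^ 2))) := by ring
    have hintc : Continuous fun x => ⟪u x, Torus.convect u φ x⟫ :=
      huc.inner ((hu.convect hφs).continuous)
    show |∫ x, (‖w x‖ ^ 2 + ε) ^ (1 / 2 : ℝ) * ⟪w x, Torus.convect u u x⟫| ≤
      2 * ∫ x, ‖u x‖ ^ 2 * ((‖w x‖ ^ 2 + ε) ^ (1 / 2 : ℝ) *
        Real.sqrt (∑ k, ‖Torus.partialDeriv k w x‖ ^ 2))
    rw [e1, hanti, abs_neg, ← integral_const_mul]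
    calc |∫ x, ⟪u x, Torus.convect u φ x⟫| ≤ ∫ x, |⟪u x, Torus.convect u φ x⟫| :=
          abs_integral_le_integral_abs
      _ ≤ ∫ x, 2 * (‖u x‖ ^ 2 * ((‖w x‖ ^ 2 + ε) ^ (1 / 2 : ℝ) *
            Real.sqrt (∑ k, ‖Torus.partialDeriv k w x‖ ^ 2))) := by
          refine integral_mono hintc.abs.integrable_unitAddTorus ?_ hbound
          refine (continuous_const.mul ((huc.norm.pow 2).mul ?_)).integrable_unitAddTorus
          exact (((hwc.norm.pow 2).add continuous_const).rpow_const
            fun x => Or.inr (by norm_num)).mul hGw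
  have h := le_of_forall_pos_le hFc hGc hval
  simpa [hFdef, hGdef] using h


omit [Fintype d] [DecidableEq d] in
/-- `(‖a‖²)^{1/2} = ‖a‖`. [folklore] -/
private theorem normSq_rpow_half {E : Type*} [NormedAddCommGroup E] (a : E) :
    (‖a‖ ^ 2) ^ (1 / 2 : ℝ) = ‖a‖ := by
  rw [← Real.sqrt_eq_rpow, Real.sqrt_sq (norm_nonneg _)]

/-- `∫ ‖z‖ ⟪z, (z·∇)z⟫ = 0` for smooth divergence-free `z` (plain-norm form of
`integral_norm_mul_inner_convect_self_eq_zero`). [cite: RobinsonRodrigoSadowski2016, Ch. 11 Exercise 11.3] -/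
theorem integral_norm_mul_inner_convect_self_eq_zero' {z : UnitAddTorus d → EuclideanSpace ℝ d}
    (hz : Torus.IsSmooth z) (hdiv : Torus.IsDivFree z) :
    ∫ x, ‖z x‖ * ⟪z x, Torus.convect z z x⟫ = 0 := by
  have h := integral_norm_mul_inner_convect_self_eq_zero hz hdiv
  simp only [normSq_rpow_half] at h
  exact h

/-- `|∫ ‖w‖ ⟪w, (u·∇)u⟫| ≤ 2 ∫ ‖u‖² ‖w‖ (∑ₖ‖∂ₖw‖²)^{1/2}` (plain-norm form of
`abs_integral_norm_mul_inner_convect_le`). [cite: RobinsonSadowski2014, Theorem 5 (proof, p. 170)] -/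
theorem abs_integral_norm_mul_inner_convect_le' {u w : UnitAddTorus d → EuclideanSpace ℝ d}
    (hu : Torus.IsSmooth u) (hdiv : Torus.IsDivFree u) (hw : Torus.IsSmooth w) :
    |∫ x, ‖w x‖ * ⟪w x, Torus.convect u u x⟫| ≤
      2 * ∫ x, ‖u x‖ ^ 2 * (‖w x‖ * Real.sqrt (∑ k, ‖Torus.partialDeriv k w x‖ ^ 2)) := by
  have h := abs_integral_norm_mul_inner_convect_le hu hdiv hw
  simp only [normSq_rpow_half] at h
  exact h

/-! ## 3. The splitting `u = v + w` as two classical forced systems -/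

/-- A jointly smooth solution of the heat equation `∂ₜv = νΔv` with divergence-free slices is a
classical solution of the Navier–Stokes system with force `(v·∇)v` and zero pressure (so that the
tree's velocity balances apply to it). [folklore] -/
private theorem isClassicalNS_of_heat {S : Set ℝ} {ν : ℝ} {v : ℝ → UnitAddTorus d → EuclideanSpace ℝ d}
    (hv : Torus.IsSmoothSpaceTimeOn S v)
    (hheat : ∀ t ∈ S, ∀ x, Torus.timeDerivWithin S v t x = ν • Torus.laplacian (v t) x)
    (hdiv : ∀ t ∈ S, Torus.IsDivFree (v t)) :
    Torus.IsClassicalNSSolutionOn S ν (fun t => Torus.convect (v t) (v t)) v (fun _ _ => 0) where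
  smooth_velocity := hv
  smooth_pressure := Torus.isSmoothSpaceTimeOn_const (Torus.isSmooth_const (0 : ℝ)) S
  momentum t ht x := by
    have hg : Torus.gradient (fun _ : UnitAddTorus d => (0 : ℝ)) x = 0 := by
      unfold Torus.gradient Torus.liftAt
      simp [_root_.gradient]
    have hg' : Torus.gradient ((fun _ _ => (0 : ℝ)) t : UnitAddTorus d → ℝ) x = 0 := hg
    rw [hheat t ht x, hg', sub_zero]
  divFree := hdiv

/-- **The remainder system** (Robinson–Sadowski 2014, (4)–(5): `u = v + w`, `vₜ − Δv = 0`,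
`wₜ − Δw + (u·∇)u + ∇p = 0`). If `(u, p)` is a classical solution of the unforced Navier–Stokes
system on `S × T^d` and `v` a jointly smooth solution of `∂ₜv = νΔv` on `S` with divergence-free
slices, then `w = u − v` is a classical solution of the FORCED system with the same pressure and
force `(w·∇)w − (u·∇)u`: `∂ₜw + (w·∇)w = νΔw − ∇p + ((w·∇)w − (u·∇)u)`.
[cite: RobinsonSadowski2014, eqs. (4)–(5) (p. 161)] -/
theorem isClassicalNS_sub_heat {S : Set ℝ} {ν : ℝ} (hS : UniqueDiffOn ℝ S)
    {u v : ℝ → UnitAddTorus d → EuclideanSpace ℝ d} {p : ℝ → UnitAddTorus d → ℝ}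
    (h : Torus.IsClassicalNSSolutionOn S ν 0 u p) (hv : Torus.IsSmoothSpaceTimeOn S v)
    (hheat : ∀ t ∈ S, ∀ x, Torus.timeDerivWithin S v t x = ν • Torus.laplacian (v t) x)
    (hdiv : ∀ t ∈ S, Torus.IsDivFree (v t)) :
    Torus.IsClassicalNSSolutionOn S ν
      (fun t x => Torus.convect (fun y => u t y - v t y) (fun y => u t y - v t y) x -
        Torus.convect (u t) (u t) x)
      (fun t x => u t x - v t x) p where
  smooth_velocity := h.smooth_velocity.sub hv
  smooth_pressure := h.smooth_pressure
  momentum t ht x := by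
    have h1 := h.momentum t ht x
    have h2 := hheat t ht x
    have hut : Torus.IsSmooth (u t) := h.smooth_velocity.isSmooth_slice ht
    have hvt : Torus.IsSmooth (v t) := hv.isSmooth_slice ht
    have hsub : Torus.timeDerivWithin S (fun s y => u s y - v s y) t x =
        Torus.timeDerivWithin S u t x - Torus.timeDerivWithin S v t x := by
      unfold Torus.timeDerivWithin
      exact ((h.smooth_velocity.hasDerivWithinAt_slice ht x).sub
        (hv.hasDerivWithinAt_slice ht x)).derivWithin (hS t ht)
    have hlap : Torus.laplacian (fun y => u t y - v t y) x =
        Torus.laplacian (u t) x - Torus.laplacian (v t) x := by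
      have e : (fun y => u t y - v t y) = u t - v t := rfl
      have hu1 : Torus.IsContDiff 1 (u t) := hut.isContDiff (by simp)
      have hv1 : Torus.IsContDiff 1 (v t) := hvt.isContDiff (by simp)
      rw [e, Torus.laplacian_eq_sum_partialDeriv_partialDeriv (hut.sub hvt),
        Torus.laplacian_eq_sum_partialDeriv_partialDeriv hut,
        Torus.laplacian_eq_sum_partialDeriv_partialDeriv hvt, ← Finset.sum_sub_distrib]
      refine Finset.sum_congr rfl fun i _ => ?_
      rw [Torus.partialDeriv_sub hu1 hv1,
        Torus.partialDeriv_sub ((hut.partialDeriv i).isContDiff (by simp))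
          ((hvt.partialDeriv i).isContDiff (by simp))]
      rfl
    rw [hsub, hlap]
    simp only [Pi.zero_apply, add_zero] at h1
    rw [h2, smul_sub]
    -- `∂ₜu + ((u−v)·∇)(u−v) = (νΔu − ∇p − (u·∇)u) + ((u−v)·∇)(u−v)`
    have e1 : Torus.timeDerivWithin S u t x =
        ν • Torus.laplacian (u t) x - Torus.gradient (p t) x - Torus.convect (u t) (u t) x := by
      rw [← h1]; abel
    rw [e1]
    abel
  divFree t ht x := by
    have hut : Torus.IsContDiff 1 (u t) := (h.smooth_velocity.isSmooth_slice ht).isContDiff (by simp)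
    have hvt : Torus.IsContDiff 1 (v t) := (hv.isSmooth_slice ht).isContDiff (by simp)
    have e : (fun y => u t y - v t y) = u t - v t := rfl
    rw [e, Torus.divergence_sub hut hvt, h.divFree t ht x, hdiv t ht x, sub_zero]

/-! ## 4. Differentiability and continuity in time of the moments -/

omit [DecidableEq d] in
/-- `s ↦ ∫‖z(s)‖^q` is differentiable within `[a, b]` along a jointly smooth field (`q ≥ 2`):
dominated differentiation of `(‖z‖²)^{q/2}` (as in `TorusNSSmallL3Global`). [folklore] -/
private theorem hasDerivWithinAt_integral_norm_rpow {a b : ℝ}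
    {z : ℝ → UnitAddTorus d → EuclideanSpace ℝ d} (hz : Torus.IsSmoothSpaceTimeOn (Icc a b) z)
    (hab : a < b) {q : ℝ} (hq : 2 ≤ q) {t : ℝ} (ht : t ∈ Icc a b) :
    ∃ R : ℝ, HasDerivWithinAt (fun s => ∫ x, ‖z s x‖ ^ q) R (Icc a b) t := by
  set S : Set ℝ := Icc a b with hS
  have hU : UniqueDiffOn ℝ S := uniqueDiffOn_Icc hab
  set Q : ℝ → UnitAddTorus d → ℝ := fun s x => ‖z s x‖ ^ 2 with hQ
  have hQst : Torus.IsSmoothSpaceTimeOn S Q := by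
    have h1 := hz.inner hz
    have e : Q = fun s x => ⟪z s x, z s x⟫ := by
      funext s x; rw [hQ, real_inner_self_eq_norm_sq]
    rw [e]; exact h1
  set Q' : ℝ → UnitAddTorus d → ℝ := Torus.timeDerivWithin S Q with hQ'
  have hQ'st : Torus.IsSmoothSpaceTimeOn S Q' := hQst.timeDerivWithin hU
  obtain ⟨B₁, hB₁⟩ := hQst.exists_norm_le_of_isCompact isCompact_Icc subset_rfl
  obtain ⟨B₂, hB₂⟩ := hQ'st.exists_norm_le_of_isCompact isCompact_Icc subset_rfl
  have hB₁0 : 0 ≤ B₁ := (norm_nonneg _).trans (hB₁ t ht (0 : UnitAddTorus d))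
  have hB₂0 : 0 ≤ B₂ := (norm_nonneg _).trans (hB₂ t ht (0 : UnitAddTorus d))
  have hr0 : 0 ≤ q / 2 - 1 := by linarith
  have h1q : (1 : ℝ) ≤ q / 2 := by linarith
  set F : ℝ → UnitAddTorus d → ℝ := fun s x => (Q s x) ^ (q / 2) with hF
  set F' : ℝ → UnitAddTorus d → ℝ := fun s x => q / 2 * (Q s x) ^ (q / 2 - 1) * Q' s x with hF'
  have hQ0 : ∀ s x, 0 ≤ Q s x := fun s x => by rw [hQ]; positivity
  have hderiv : ∀ s ∈ S, ∀ x, HasDerivWithinAt (F · x) (F' s x) S s := by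
    intro s hs x
    have h1 : HasDerivWithinAt (fun τ => Q τ x) (Q' s x) S s := hQst.hasDerivWithinAt_slice hs x
    have h2 := (Real.hasDerivAt_rpow_const (p := q / 2) (x := Q s x) (Or.inr h1q)).comp_hasDerivWithinAt s h1
    have e : F' s x = q / 2 * Q s x ^ (q / 2 - 1) * Q' s x := rfl
    rw [e]
    exact h2
  have hF_int : ∀ s ∈ S, Integrable (F s) volume := fun s hs =>
    (((hQst.isSmooth_slice hs).continuous).rpow_const fun x => Or.inr (by linarith)).integrable_unitAddTorus
  have hbound : ∀ᶠ s in 𝓝[S] t, ∀ x, ‖F' s x‖ ≤ q / 2 * B₁ ^ (q / 2 - 1) * B₂ := by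
    refine eventually_nhdsWithin_of_forall fun s hs x => ?_
    have hQle : Q s x ≤ B₁ := by
      have := hB₁ s hs x
      rw [Real.norm_of_nonneg (hQ0 s x)] at this
      exact this
    have h1 : Q s x ^ (q / 2 - 1) ≤ B₁ ^ (q / 2 - 1) := Real.rpow_le_rpow (hQ0 s x) hQle hr0
    have h2 : |Q' s x| ≤ B₂ := by
      have := hB₂ s hs x
      rwa [Real.norm_eq_abs] at this
    rw [hF', Real.norm_eq_abs]
    simp only
    rw [abs_mul, abs_mul, abs_of_nonneg (by linarith : (0 : ℝ) ≤ q / 2),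
      abs_of_nonneg (Real.rpow_nonneg (hQ0 s x) _)]
    have hq2 : (0 : ℝ) ≤ q / 2 := by linarith
    calc q / 2 * Q s x ^ (q / 2 - 1) * |Q' s x| ≤ q / 2 * B₁ ^ (q / 2 - 1) * B₂ := by
          gcongr
    _ = q / 2 * B₁ ^ (q / 2 - 1) * B₂ := rfl
  have hF'_meas : AEStronglyMeasurable (F' t) volume := by
    have hc : Continuous (F' t) :=
      ((continuous_const.mul (((hQst.isSmooth_slice ht).continuous).rpow_const
        fun x => Or.inr hr0)).mul (hQ'st.isSmooth_slice ht).continuous)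
    exact hc.aestronglyMeasurable
  have hmain := Torus.hasDerivWithinAt_integral_of_convex (μ := volume) (convex_Icc a b) ht
    hF_int hderiv hbound hF'_meas
  refine ⟨∫ x, F' t x, ?_⟩
  have e : (fun s => ∫ x, ‖z s x‖ ^ q) = fun s => ∫ x, F s x := by
    funext s
    refine integral_congr_ae (ae_of_all _ fun x => ?_)
    show ‖z s x‖ ^ q = (‖z s x‖ ^ 2) ^ (q / 2)
    rw [← Real.rpow_natCast, ← Real.rpow_mul (norm_nonneg _)]
    congr 1; push_cast; ring
  rw [e]
  exact hmain

/-- Along a jointly smooth field on `[a, b]`, the weighted dissipation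
`t ↦ ∫‖z(t)‖ ∑ₖ‖∂ₖz(t)‖²` is continuous on `[a, b]` (tube lemma). [folklore] -/
private theorem continuousOn_weightedDissipation {a b : ℝ} (hab : a < b)
    {z : ℝ → UnitAddTorus d → EuclideanSpace ℝ d} (hz : Torus.IsSmoothSpaceTimeOn (Icc a b) z) :
    ContinuousOn (fun t => ∫ x, ‖z t x‖ * ∑ k, ‖Torus.partialDeriv k (z t) x‖ ^ 2) (Icc a b) := by
  have hU : UniqueDiffOn ℝ (Icc a b) := uniqueDiffOn_Icc hab
  have hst : ContinuousOn (Torus.stLift z) (Icc a b ×ˢ univ) := hz.continuousOn_stLift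
  have hDst : ∀ k, ContinuousOn (Torus.stLift fun t x => Torus.partialDeriv k (z t) x)
      (Icc a b ×ˢ univ) := fun k => (hz.partialDeriv hU k).continuousOn_stLift
  refine Torus.continuousOn_integral_of_continuousOn_stLift ?_
  have e : Torus.stLift (fun t x => ‖z t x‖ * ∑ k, ‖Torus.partialDeriv k (z t) x‖ ^ 2) =
      fun q => ‖Torus.stLift z q‖ *
        ∑ k, ‖Torus.stLift (fun t x => Torus.partialDeriv k (z t) x) q‖ ^ 2 := rfl
  rw [e]
  exact hst.norm.mul (continuousOn_finsetSum _ fun k _ => (hDst k).norm.pow 2)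

omit [DecidableEq d] in
/-- Along a jointly smooth field, `t ↦ ∫ ‖z(t)‖^r` (`r ≥ 0`) is continuous on the time set.
[folklore] -/
private theorem continuousOn_integral_norm_rpow {S : Set ℝ}
    {z : ℝ → UnitAddTorus d → EuclideanSpace ℝ d} (hz : Torus.IsSmoothSpaceTimeOn S z)
    {r : ℝ} (hr : 0 ≤ r) :
    ContinuousOn (fun t => ∫ x, ‖z t x‖ ^ r) S := by
  have hst : ContinuousOn (Torus.stLift z) (S ×ˢ univ) := hz.continuousOn_stLift
  refine Torus.continuousOn_integral_of_continuousOn_stLift ?_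
  have e : Torus.stLift (fun t x => ‖z t x‖ ^ r) = fun q => ‖Torus.stLift z q‖ ^ r := rfl
  rw [e]
  exact hst.norm.rpow_const fun q _ => Or.inr hr

/-! ## 5. The heat part: `L³` decay with dissipation (Robinson–Sadowski 2014, (17)) -/

/-- **`L³` decay of the heat flow with its dissipation** (Robinson–Sadowski 2014, (17):
`‖v(t)‖³_{L³} + 3∫₀ᵗ∫|∇v|²|v| ≤ ‖u₀‖³_{L³}`). For a jointly smooth solution `v` of `∂ₜv = νΔv`
(`ν > 0`) on `[a, b] × T^d` with divergence-free slices and every `t ∈ [a, b]`,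
`∫‖v(t)‖³ + 3ν ∫ₐᵗ ∫ ‖v‖ ∑ₖ‖∂ₖv‖² ≤ ∫‖v(a)‖³` — the `L³` balance (RRS (11.19) at `α = 3`, zero
pressure) in which the transport term `∫‖v‖⟪v,(v·∇)v⟫` vanishes.
[cite: RobinsonSadowski2014, eq. (17) (p. 169)] -/
theorem heat_integral_norm_cube_add_dissipation_le {ν a b : ℝ} (hν : 0 < ν) (hab : a < b)
    {v : ℝ → UnitAddTorus d → EuclideanSpace ℝ d} (hv : Torus.IsSmoothSpaceTimeOn (Icc a b) v)
    (hheat : ∀ t ∈ Icc a b, ∀ x, Torus.timeDerivWithin (Icc a b) v t x = ν • Torus.laplacian (v t) x)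
    (hdiv : ∀ t ∈ Icc a b, Torus.IsDivFree (v t)) {t : ℝ} (ht : t ∈ Icc a b) :
    (∫ x, ‖v t x‖ ^ (3 : ℝ)) +
        3 * ν * ∫ s in a..t, ∫ x, ‖v s x‖ * ∑ k, ‖Torus.partialDeriv k (v s) x‖ ^ 2 ≤
      ∫ x, ‖v a x‖ ^ (3 : ℝ) := by
  have hNS := isClassicalNS_of_heat hv hheat hdiv
  set U : ℝ → ℝ := fun s => ∫ x, ‖v s x‖ ^ (3 : ℝ) with hU
  set X : ℝ → ℝ := fun s => ∫ x, ‖v s x‖ * ∑ k, ‖Torus.partialDeriv k (v s) x‖ ^ 2 with hX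
  -- derivatives of `U` within `[a, b]`
  have hder : ∀ s ∈ Icc a b, ∃ R, HasDerivWithinAt U R (Icc a b) s := fun s hs =>
    hasDerivWithinAt_integral_norm_rpow hv hab (by norm_num) hs
  choose! Ud hUd using hder
  -- the balance: `Ud s ≤ -3ν X s`
  have hUd_le : ∀ s ∈ Icc a b, Ud s ≤ -(3 * ν * X s) := by
    intro s hs
    have e_fun : (fun s => ∫ x, ‖v s x‖ ^ (3 : ℝ)) = fun s => ∫ x, (‖v s x‖ ^ 2) ^ ((3 : ℝ) / 2) := by
      funext s
      refine integral_congr_ae (ae_of_all _ fun x => ?_)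
      show ‖v s x‖ ^ (3 : ℝ) = (‖v s x‖ ^ 2) ^ ((3 : ℝ) / 2)
      rw [← Real.rpow_natCast, ← Real.rpow_mul (norm_nonneg _)]
      norm_num
    have hR : HasDerivWithinAt (fun s => ∫ x, (‖v s x‖ ^ 2) ^ ((3 : ℝ) / 2)) (Ud s) (Icc a b) s := by
      rw [← e_fun]; exact hUd s hs
    have hbal := hNS.deriv_integral_normSq_rpow_le_of_two_le hν hab (α := 3) (by norm_num) hs hR
    have hvs : Torus.IsSmooth (v s) := hv.isSmooth_slice hs
    have hpw : ∀ x, (‖v s x‖ ^ 2) ^ ((3 : ℝ) / 2 - 1) = ‖v s x‖ := by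
      intro x
      rw [show (3 : ℝ) / 2 - 1 = 1 / 2 by norm_num]
      exact normSq_rpow_half _
    simp only [hpw] at hbal
    have htr : ∫ x, ‖v s x‖ * ⟪v s x, Torus.convect (v s) (v s) x⟫ = 0 :=
      integral_norm_mul_inner_convect_self_eq_zero' hvs (hdiv s hs)
    rw [htr, mul_zero, add_zero] at hbal
    simpa [hX] using hbal
  -- `Φ = U + 3ν ∫ₐ X` is non-increasing
  have hXc : ContinuousOn X (Icc a b) := continuousOn_weightedDissipation hab hv
  have hXnn : ∀ s, 0 ≤ X s := fun s => integral_nonneg fun x =>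
    mul_nonneg (norm_nonneg _) (Finset.sum_nonneg fun k _ => sq_nonneg _)
  set Pr : ℝ → ℝ := fun s => ∫ r in a..s, X r with hPr
  have hPrd : ∀ s ∈ Icc a b, HasDerivWithinAt Pr (X s) (Icc a b) s := by
    intro s hs
    haveI : Fact (s ∈ Icc a b) := ⟨hs⟩
    have hint : IntervalIntegrable X volume a s :=
      (hXc.mono (Icc_subset_Icc_right hs.2)).intervalIntegrable_of_Icc hs.1
    exact intervalIntegral.integral_hasDerivWithinAt_right hint
      (hXc.stronglyMeasurableAtFilter_nhdsWithin measurableSet_Icc s) (hXc s hs)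
  set Φ : ℝ → ℝ := fun s => U s + 3 * ν * Pr s with hΦ
  have hΦd : ∀ s ∈ Icc a b, HasDerivWithinAt Φ (Ud s + 3 * ν * X s) (Icc a b) s :=
    fun s hs => (hUd s hs).add ((hPrd s hs).const_mul _)
  have hΦanti : AntitoneOn Φ (Icc a b) :=
    antitoneOn_of_hasDerivWithinAt_nonpos (convex_Icc a b)
      (fun s hs => (hΦd s hs).continuousWithinAt)
      (fun s hs => (hΦd s (interior_subset hs)).mono interior_subset)
      (fun s hs => by linarith [hUd_le s (interior_subset hs)])
  have hΦa : Φ a = U a := by simp [hΦ, hPr]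
  have h1 := hΦanti ⟨le_rfl, hab.le⟩ ht ht.1
  rw [hΦa] at h1
  have h2 : U t + 3 * ν * Pr t ≤ U a := h1
  simpa only [hU, hPr] using h2


/-! ## 6. Young's inequality in the two shapes used, and power bookkeeping -/

omit [Fintype d] [DecidableEq d] in
/-- Young / weighted AM–GM, cube-root shape: `y x^{1/3} ≤ (ν/4) x + ν^{−1/2} y^{3/2}` for
`x, y ≥ 0`, `ν > 0` (from `p₁^{1/3} p₂^{2/3} ≤ p₁/3 + 2p₂/3` with `p₁ = (3ν/4)x`,
`p₂ = (3ν/4)^{−1/2} y^{3/2}`, and `(2/3)(4/3)^{1/2} ≤ 1`). [folklore] -/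
private theorem young_cube_root {x y ν : ℝ} (hx : 0 ≤ x) (hy : 0 ≤ y) (hν : 0 < ν) :
    y * x ^ (1 / 3 : ℝ) ≤ ν / 4 * x + ν ^ (-(1 / 2 : ℝ)) * y ^ (3 / 2 : ℝ) := by
  set η : ℝ := 3 * ν / 4 with hη
  have hη0 : 0 < η := by rw [hη]; positivity
  set p₁ : ℝ := η * x with hp₁
  set p₂ : ℝ := η ^ (-(1 / 2 : ℝ)) * y ^ (3 / 2 : ℝ) with hp₂
  have hp₁0 : 0 ≤ p₁ := by rw [hp₁]; positivity
  have hp₂0 : 0 ≤ p₂ := by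
    rw [hp₂]; exact mul_nonneg (Real.rpow_nonneg hη0.le _) (Real.rpow_nonneg hy _)
  have hamgm := Real.geom_mean_le_arith_mean2_weighted (w₁ := 1 / 3) (w₂ := 2 / 3)
    (p₁ := p₁) (p₂ := p₂) (by norm_num) (by norm_num) hp₁0 hp₂0 (by norm_num)
  -- identify the geometric mean with `y x^{1/3}`
  have e1 : p₁ ^ (1 / 3 : ℝ) = η ^ (1 / 3 : ℝ) * x ^ (1 / 3 : ℝ) := by
    rw [hp₁, Real.mul_rpow hη0.le hx]
  have e2 : p₂ ^ (2 / 3 : ℝ) = η ^ (-(1 / 3 : ℝ)) * y := by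
    rw [hp₂, Real.mul_rpow (Real.rpow_nonneg hη0.le _) (Real.rpow_nonneg hy _),
      ← Real.rpow_mul hη0.le, ← Real.rpow_mul hy]
    norm_num
  have e3 : η ^ (1 / 3 : ℝ) * η ^ (-(1 / 3 : ℝ)) = 1 := by
    rw [← Real.rpow_add hη0]; norm_num
  have hgm : p₁ ^ (1 / 3 : ℝ) * p₂ ^ (2 / 3 : ℝ) = y * x ^ (1 / 3 : ℝ) := by
    rw [e1, e2]
    calc η ^ (1 / 3 : ℝ) * x ^ (1 / 3 : ℝ) * (η ^ (-(1 / 3 : ℝ)) * y)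
        = (η ^ (1 / 3 : ℝ) * η ^ (-(1 / 3 : ℝ))) * (y * x ^ (1 / 3 : ℝ)) := by ring
      _ = y * x ^ (1 / 3 : ℝ) := by rw [e3, one_mul]
  rw [hgm] at hamgm
  -- the two arithmetic-mean terms
  have ht1 : (1 / 3 : ℝ) * p₁ = ν / 4 * x := by rw [hp₁, hη]; ring
  -- `(2/3) η^{-1/2} ≤ ν^{-1/2}` since `η = (3/4)ν` and `(2/3)(3/4)^{-1/2} ≤ 1`
  have ht2 : (2 / 3 : ℝ) * p₂ ≤ ν ^ (-(1 / 2 : ℝ)) * y ^ (3 / 2 : ℝ) := by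
    rw [hp₂, ← mul_assoc]
    refine mul_le_mul_of_nonneg_right ?_ (Real.rpow_nonneg hy _)
    have eη : η ^ (-(1 / 2 : ℝ)) = (3 / 4 : ℝ) ^ (-(1 / 2 : ℝ)) * ν ^ (-(1 / 2 : ℝ)) := by
      rw [hη, show 3 * ν / 4 = (3 / 4 : ℝ) * ν by ring,
        Real.mul_rpow (by norm_num : (0 : ℝ) ≤ 3 / 4) hν.le]
    rw [eη, ← mul_assoc]
    refine mul_le_of_le_one_left (Real.rpow_nonneg hν.le _) ?_
    -- `(2/3) (3/4)^{-1/2} ≤ 1`: square both sides, `(4/9)(4/3) = 16/27 ≤ 1`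
    have hpos : 0 < (3 / 4 : ℝ) ^ (-(1 / 2 : ℝ)) := Real.rpow_pos_of_pos (by norm_num) _
    have hsq : ((3 / 4 : ℝ) ^ (-(1 / 2 : ℝ))) ^ 2 = 4 / 3 := by
      rw [← Real.rpow_natCast, ← Real.rpow_mul (by norm_num : (0 : ℝ) ≤ 3 / 4)]
      norm_num
    nlinarith [hsq, hpos]
  linarith [hamgm, ht1, ht2]

omit [Fintype d] [DecidableEq d] in
/-- Young / weighted AM–GM, `2/3`-power shape: `y x^{2/3} ≤ (ν/4) x + (64/27) ν⁻² y³` for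
`x, y ≥ 0`, `ν > 0` (`p₁^{2/3} p₂^{1/3} ≤ 2p₁/3 + p₂/3` with `p₁ = (3ν/8)x`, `p₂ = (3ν/8)⁻² y³`).
[folklore] -/
private theorem young_two_thirds {x y ν : ℝ} (hx : 0 ≤ x) (hy : 0 ≤ y) (hν : 0 < ν) :
    y * x ^ (2 / 3 : ℝ) ≤ ν / 4 * x + 64 / 27 * ν⁻¹ ^ 2 * y ^ 3 := by
  set η : ℝ := 3 * ν / 8 with hη
  have hη0 : 0 < η := by rw [hη]; positivity
  set p₁ : ℝ := η * x with hp₁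
  set p₂ : ℝ := η⁻¹ ^ 2 * y ^ 3 with hp₂
  have hp₁0 : 0 ≤ p₁ := by rw [hp₁]; positivity
  have hp₂0 : 0 ≤ p₂ := by rw [hp₂]; positivity
  have hamgm := Real.geom_mean_le_arith_mean2_weighted (w₁ := 2 / 3) (w₂ := 1 / 3)
    (p₁ := p₁) (p₂ := p₂) (by norm_num) (by norm_num) hp₁0 hp₂0 (by norm_num)
  have e1 : p₁ ^ (2 / 3 : ℝ) = η ^ (2 / 3 : ℝ) * x ^ (2 / 3 : ℝ) := by
    rw [hp₁, Real.mul_rpow hη0.le hx]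
  have e2 : p₂ ^ (1 / 3 : ℝ) = η ^ (-(2 / 3 : ℝ)) * y := by
    rw [hp₂, Real.mul_rpow (by positivity) (by positivity)]
    have ea : (η⁻¹ ^ 2 : ℝ) ^ (1 / 3 : ℝ) = η ^ (-(2 / 3 : ℝ)) := by
      rw [← Real.rpow_natCast, ← Real.rpow_mul (inv_nonneg.2 hη0.le), Real.inv_rpow hη0.le,
        ← Real.rpow_neg hη0.le]
      norm_num
    have eb : (y ^ 3 : ℝ) ^ (1 / 3 : ℝ) = y := by
      rw [← Real.rpow_natCast, ← Real.rpow_mul hy]; norm_num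
    rw [ea, eb]
  have e3 : η ^ (2 / 3 : ℝ) * η ^ (-(2 / 3 : ℝ)) = 1 := by
    rw [← Real.rpow_add hη0]; norm_num
  have hgm : p₁ ^ (2 / 3 : ℝ) * p₂ ^ (1 / 3 : ℝ) = y * x ^ (2 / 3 : ℝ) := by
    rw [e1, e2]
    calc η ^ (2 / 3 : ℝ) * x ^ (2 / 3 : ℝ) * (η ^ (-(2 / 3 : ℝ)) * y)
        = (η ^ (2 / 3 : ℝ) * η ^ (-(2 / 3 : ℝ))) * (y * x ^ (2 / 3 : ℝ)) := by ring
      _ = y * x ^ (2 / 3 : ℝ) := by rw [e3, one_mul]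
  rw [hgm] at hamgm
  have ht1 : (2 / 3 : ℝ) * p₁ = ν / 4 * x := by rw [hp₁, hη]; ring
  have ht2 : (1 / 3 : ℝ) * p₂ = 64 / 27 * ν⁻¹ ^ 2 * y ^ 3 := by
    rw [hp₂, hη]
    field_simp
    ring
  linarith [hamgm, ht1, ht2]

omit [Fintype d] [DecidableEq d] in
/-- `(a + b)^p ≤ 2^{p−1}(a^p + b^p)` for `a, b ≥ 0`, `p ≥ 1` (real form of
`NNReal.rpow_add_le_mul_rpow_add_rpow`). [folklore] -/
private theorem add_rpow_le_two_rpow_mul {a b p : ℝ} (ha : 0 ≤ a) (hb : 0 ≤ b) (hp : 1 ≤ p) :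
    (a + b) ^ p ≤ 2 ^ (p - 1) * (a ^ p + b ^ p) := by
  have h := NNReal.rpow_add_le_mul_rpow_add_rpow ⟨a, ha⟩ ⟨b, hb⟩ hp
  have h' := NNReal.coe_le_coe.2 h
  push_cast at h'
  exact h'

omit [Fintype d] [DecidableEq d] in
/-- `ν^{−1/2} (ν⁻¹)^{3/2} = ν⁻²` for `ν > 0`. [folklore] -/
private theorem rpow_neg_half_mul_inv_rpow_three_halves {ν : ℝ} (hν : 0 < ν) :
    ν ^ (-(1 / 2 : ℝ)) * ν⁻¹ ^ (3 / 2 : ℝ) = ν⁻¹ ^ 2 := by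
  rw [Real.inv_rpow hν.le, ← Real.rpow_neg hν.le, ← Real.rpow_add hν, ← Real.rpow_natCast,
    Real.inv_rpow hν.le, ← Real.rpow_neg hν.le]
  norm_num


omit [Fintype d] [DecidableEq d] in
/-- `(a + b)^p ≤ a^p + b^p` for `a, b ≥ 0`, `0 ≤ p ≤ 1` (real form of
`NNReal.rpow_add_le_add_rpow`). [folklore] -/
private theorem add_rpow_le_add_rpow {a b p : ℝ} (ha : 0 ≤ a) (hb : 0 ≤ b) (hp : 0 ≤ p) (hp1 : p ≤ 1) :
    (a + b) ^ p ≤ a ^ p + b ^ p := by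
  have h := NNReal.rpow_add_le_add_rpow ⟨a, ha⟩ ⟨b, hb⟩ hp hp1
  have h' := NNReal.coe_le_coe.2 h
  push_cast at h'
  exact h'

/-! ## 7. Lebesgue-norm bookkeeping on `T³`: Robinson–Sadowski's Lemma 2 and interpolations -/

/-- **Robinson–Sadowski 2014, Lemma 2** at `a = 3`, cube form: there is `c = c(d) ≥ 0` with
`(∫‖z‖⁹)^{1/3} = ‖z‖³_{L⁹} ≤ c ∫ ‖z‖ ∑ₖ‖∂ₖz‖² = c ∫ |∇z|²|z|` for every smooth mean-zero `z` on
`T^d`, `card d = 3` (tree: `Torus.exists_rpow_integral_norm_rpow_le_weighted`).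
[cite: RobinsonSadowski2014, Lemma 2 (p. 164)] -/
theorem exists_L9_cube_le_weightedDissipation (hd : Fintype.card d = 3) :
    ∃ c : ℝ, 0 ≤ c ∧ ∀ z : UnitAddTorus d → EuclideanSpace ℝ d, Torus.IsSmooth z →
      Torus.HasZeroMean z →
        (∫ x, ‖z x‖ ^ (9 : ℝ)) ^ (1 / 3 : ℝ) ≤ c * ∫ x, ‖z x‖ * ∑ k, ‖Torus.partialDeriv k z x‖ ^ 2 := by
  obtain ⟨c, hc0, hc⟩ := Torus.exists_rpow_integral_norm_rpow_le_weighted (d := d) hd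
    (a := 3) (by norm_num)
  refine ⟨c, hc0, fun z hz h0 => ?_⟩
  have h := hc z hz h0
  rw [show (3 : ℝ) * 3 = 9 by norm_num, show (3 : ℝ) - 2 = 1 by norm_num] at h
  simpa only [Real.rpow_one] using h

omit [DecidableEq d] in
/-- Interpolation `‖v‖⁶_{L^{9/2}} ≤ ‖v‖³_{L³} ‖v‖³_{L⁹}` in integral form: with
`M = (∫‖v‖^{9/2})^{8/9}` (`= ‖v‖⁴_{L^{9/2}}`), `M^{3/2} ≤ (∫‖v‖³)(∫‖v‖⁹)^{1/3}`. [folklore] -/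
private theorem rpow_L92_three_halves_le {v : UnitAddTorus d → EuclideanSpace ℝ d} (hv : Continuous v) :
    ((∫ x, ‖v x‖ ^ (9 / 2 : ℝ)) ^ (8 / 9 : ℝ)) ^ (3 / 2 : ℝ) ≤
      (∫ x, ‖v x‖ ^ (3 : ℝ)) * (∫ x, ‖v x‖ ^ (9 : ℝ)) ^ (1 / 3 : ℝ) := by
  have hA0 : 0 ≤ ∫ x, ‖v x‖ ^ (9 / 2 : ℝ) := integral_nonneg fun x => Real.rpow_nonneg (norm_nonneg _) _
  have hU0 : 0 ≤ ∫ x, ‖v x‖ ^ (3 : ℝ) := integral_nonneg fun x => Real.rpow_nonneg (norm_nonneg _) _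
  have hB0 : 0 ≤ ∫ x, ‖v x‖ ^ (9 : ℝ) := integral_nonneg fun x => Real.rpow_nonneg (norm_nonneg _) _
  have hint := integral_norm_rpow_le_interpolate hv (p := 3) (q := 9) (r := 9 / 2) (a := 3 / 4)
    (b := 1 / 4) (by norm_num) (by norm_num) (by norm_num) (by norm_num) (by norm_num) (by norm_num)
  -- raise to the power `4/3`
  have h43 := Real.rpow_le_rpow hA0 hint (by norm_num : (0 : ℝ) ≤ 4 / 3)
  rw [Real.mul_rpow (Real.rpow_nonneg hU0 _) (Real.rpow_nonneg hB0 _),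
    ← Real.rpow_mul hU0, ← Real.rpow_mul hB0] at h43
  rw [← Real.rpow_mul hA0]
  norm_num at h43 ⊢
  exact h43

omit [DecidableEq d] in
/-- Interpolation `‖w‖⁴_{L^{9/2}} ≤ ‖w‖²_{L³} ‖w‖²_{L⁹}` in integral form:
`(∫‖w‖^{9/2})^{8/9} ≤ (∫‖w‖³)^{2/3} ((∫‖w‖⁹)^{1/3})^{2/3}`. [folklore] -/
private theorem rpow_L92_le {w : UnitAddTorus d → EuclideanSpace ℝ d} (hw : Continuous w) :
    (∫ x, ‖w x‖ ^ (9 / 2 : ℝ)) ^ (8 / 9 : ℝ) ≤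
      (∫ x, ‖w x‖ ^ (3 : ℝ)) ^ (2 / 3 : ℝ) * ((∫ x, ‖w x‖ ^ (9 : ℝ)) ^ (1 / 3 : ℝ)) ^ (2 / 3 : ℝ) := by
  have hA0 : 0 ≤ ∫ x, ‖w x‖ ^ (9 / 2 : ℝ) := integral_nonneg fun x => Real.rpow_nonneg (norm_nonneg _) _
  have hU0 : 0 ≤ ∫ x, ‖w x‖ ^ (3 : ℝ) := integral_nonneg fun x => Real.rpow_nonneg (norm_nonneg _) _
  have hB0 : 0 ≤ ∫ x, ‖w x‖ ^ (9 : ℝ) := integral_nonneg fun x => Real.rpow_nonneg (norm_nonneg _) _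
  have hint := integral_norm_rpow_le_interpolate hw (p := 3) (q := 9) (r := 9 / 2) (a := 3 / 4)
    (b := 1 / 4) (by norm_num) (by norm_num) (by norm_num) (by norm_num) (by norm_num) (by norm_num)
  have h89 := Real.rpow_le_rpow hA0 hint (by norm_num : (0 : ℝ) ≤ 8 / 9)
  rw [Real.mul_rpow (Real.rpow_nonneg hU0 _) (Real.rpow_nonneg hB0 _),
    ← Real.rpow_mul hU0, ← Real.rpow_mul hB0] at h89
  rw [← Real.rpow_mul hB0]
  norm_num at h89 ⊢
  exact h89

omit [DecidableEq d] in
/-- Interpolation `‖w‖⁵_{L⁵} ≤ ‖w‖²_{L³} ‖w‖³_{L⁹}`: `∫‖w‖⁵ ≤ (∫‖w‖³)^{2/3} (∫‖w‖⁹)^{1/3}`.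
[folklore] -/
private theorem integral_norm_pow_five_le {w : UnitAddTorus d → EuclideanSpace ℝ d} (hw : Continuous w) :
    ∫ x, ‖w x‖ ^ 5 ≤ (∫ x, ‖w x‖ ^ (3 : ℝ)) ^ (2 / 3 : ℝ) * (∫ x, ‖w x‖ ^ (9 : ℝ)) ^ (1 / 3 : ℝ) := by
  have hint := integral_norm_rpow_le_interpolate hw (p := 3) (q := 9) (r := 5) (a := 2 / 3)
    (b := 1 / 3) (by norm_num) (by norm_num) (by norm_num) (by norm_num) (by norm_num) (by norm_num)
  have e : ∫ x, ‖w x‖ ^ 5 = ∫ x, ‖w x‖ ^ (5 : ℝ) :=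
    integral_congr_ae (ae_of_all _ fun x => by exact_mod_cast (Real.rpow_natCast ‖w x‖ 5).symm)
  rw [e]
  exact hint

omit [Fintype d] [DecidableEq d] in
/-- `(a + b)⁴ ≤ 8(a⁴ + b⁴)` for real `a, b`. [folklore] -/
private theorem add_pow_four_le (a b : ℝ) : (a + b) ^ 4 ≤ 8 * (a ^ 4 + b ^ 4) := by
  nlinarith [mul_nonneg (sq_nonneg (a - b)) (add_nonneg (mul_nonneg (by norm_num : (0:ℝ) ≤ 7)
    (sq_nonneg (a + 5 / 7 * b))) (mul_nonneg (by norm_num : (0:ℝ) ≤ 24 / 7) (sq_nonneg b)))]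

/-! ## 8. The convective term of the remainder system (Robinson–Sadowski 2014, `R₁ + R₂`) -/

/-- **The terms `R₁ + R₂`.** There are `K₂, K₃ ≥ 0` (depending on `d`) such that for every
`ν > 0` and all smooth `u, v` on `T^d` (`card d = 3`) with `div u = 0` and `v`, `w := u − v` of
zero mean:
`3 |∫ ‖w‖ ⟪w, (u·∇)u⟫| ≤ (ν/4) X + K₂ (∫‖w‖³)^{1/3} X + K₃ ν⁻² (∫‖v‖³) X_v`,
`X = ∫‖w‖∑ₖ‖∂ₖw‖²`, `X_v = ∫‖v‖∑ₖ‖∂ₖv‖²` — the chain IBP, `|u|² ≤ 2|v|² + 2|w|²`,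
`‖w‖_{L⁵} ≤ ‖w‖^{2/5}_{L³}‖w‖^{3/5}_{L⁹}`, Hölder `(2, 18, 9/4)`, `‖v‖_{9/2} ≤ ‖v‖₃^{1/2}‖v‖₉^{1/2}`,
Lemma 2 and Young, with the viscosity restored.
[cite: RobinsonSadowski2014, Theorem 5 (proof, p. 170)] -/
theorem exists_convective_bound (hd : Fintype.card d = 3) :
    ∃ K₂ K₃ : ℝ, 0 ≤ K₂ ∧ 0 ≤ K₃ ∧ ∀ {ν : ℝ}, 0 < ν →
      ∀ {u v : UnitAddTorus d → EuclideanSpace ℝ d}, Torus.IsSmooth u → Torus.IsSmooth v →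
        Torus.IsDivFree u → Torus.HasZeroMean v → Torus.HasZeroMean (fun y => u y - v y) →
        3 * |∫ x, ‖u x - v x‖ * ⟪u x - v x, Torus.convect u u x⟫| ≤
          ν / 4 * (∫ x, ‖u x - v x‖ * ∑ k, ‖Torus.partialDeriv k (fun y => u y - v y) x‖ ^ 2) +
          K₂ * (∫ x, ‖u x - v x‖ ^ (3 : ℝ)) ^ (1 / 3 : ℝ) *
            (∫ x, ‖u x - v x‖ * ∑ k, ‖Torus.partialDeriv k (fun y => u y - v y) x‖ ^ 2) +
          K₃ * ν⁻¹ ^ 2 * (∫ x, ‖v x‖ ^ (3 : ℝ)) *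
            (∫ x, ‖v x‖ * ∑ k, ‖Torus.partialDeriv k v x‖ ^ 2) := by
  obtain ⟨c, hc0, hc⟩ := exists_L9_cube_le_weightedDissipation (d := d) hd
  -- constants
  set kF : ℝ := 6 * (8 * c ^ (1 / 3 : ℝ)) ^ (1 / 2 : ℝ) with hkF
  have hkF0 : 0 ≤ kF := by rw [hkF]; positivity
  refine ⟨6 * (8 * c) ^ (1 / 2 : ℝ), 64 / 27 * kF ^ 3 * c, by positivity, by positivity,
    fun {ν} hν {u v} hu hv hdiv hv0 hw0 => ?_⟩
  -- notation
  set w : UnitAddTorus d → EuclideanSpace ℝ d := fun y => u y - v y with hwdef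
  have hw : Torus.IsSmooth w := hu.sub hv
  have hwc : Continuous w := hw.continuous
  have huc : Continuous u := hu.continuous
  have hvc : Continuous v := hv.continuous
  set G : UnitAddTorus d → ℝ := fun x => Real.sqrt (∑ k, ‖Torus.partialDeriv k w x‖ ^ 2) with hG
  have hGc : Continuous G :=
    (continuous_finsetSum _ fun k _ => (hw.partialDeriv k).continuous.norm.pow 2).sqrt
  have hSumc : Continuous fun x => ∑ k, ‖Torus.partialDeriv k w x‖ ^ 2 :=
    continuous_finsetSum _ fun k _ => (hw.partialDeriv k).continuous.norm.pow 2
  have hSum0 : ∀ x, 0 ≤ ∑ k, ‖Torus.partialDeriv k w x‖ ^ 2 := fun x =>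
    Finset.sum_nonneg fun k _ => sq_nonneg _
  have hG0 : ∀ x, 0 ≤ G x := fun x => Real.sqrt_nonneg _
  set X : ℝ := ∫ x, ‖w x‖ * ∑ k, ‖Torus.partialDeriv k w x‖ ^ 2 with hX
  set U : ℝ := ∫ x, ‖w x‖ ^ (3 : ℝ) with hU
  set B : ℝ := ∫ x, ‖w x‖ ^ (9 : ℝ) with hB
  set Xv : ℝ := ∫ x, ‖v x‖ * ∑ k, ‖Torus.partialDeriv k v x‖ ^ 2 with hXv
  set Uv : ℝ := ∫ x, ‖v x‖ ^ (3 : ℝ) with hUv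
  set Bv : ℝ := ∫ x, ‖v x‖ ^ (9 : ℝ) with hBv
  set M : ℝ := (∫ x, ‖v x‖ ^ (9 / 2 : ℝ)) ^ (8 / 9 : ℝ) with hM
  have hX0 : 0 ≤ X := integral_nonneg fun x => mul_nonneg (norm_nonneg _) (hSum0 x)
  have hU0 : 0 ≤ U := integral_nonneg fun x => Real.rpow_nonneg (norm_nonneg _) _
  have hB0 : 0 ≤ B := integral_nonneg fun x => Real.rpow_nonneg (norm_nonneg _) _
  have hXv0 : 0 ≤ Xv := integral_nonneg fun x => mul_nonneg (norm_nonneg _)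
    (Finset.sum_nonneg fun k _ => sq_nonneg _)
  have hUv0 : 0 ≤ Uv := integral_nonneg fun x => Real.rpow_nonneg (norm_nonneg _) _
  have hBv0 : 0 ≤ Bv := integral_nonneg fun x => Real.rpow_nonneg (norm_nonneg _) _
  have hM0 : 0 ≤ M := Real.rpow_nonneg (integral_nonneg fun x => Real.rpow_nonneg (norm_nonneg _) _) _
  -- Lemma 2 for `w` and `v`
  have hL2w : B ^ (1 / 3 : ℝ) ≤ c * X := hc w hw hw0
  have hL2v : Bv ^ (1 / 3 : ℝ) ≤ c * Xv := hc v hv hv0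
  have hcX0 : 0 ≤ c * X := mul_nonneg hc0 hX0
  -- `L = B^{1/9} ≤ (cX)^{1/3}`
  have hL : B ^ (1 / 9 : ℝ) ≤ (c * X) ^ (1 / 3 : ℝ) := by
    have e : B ^ (1 / 9 : ℝ) = (B ^ (1 / 3 : ℝ)) ^ (1 / 3 : ℝ) := by
      rw [← Real.rpow_mul hB0]; norm_num
    rw [e]
    exact Real.rpow_le_rpow (Real.rpow_nonneg hB0 _) hL2w (by norm_num)
  -- ### Step 1: derivatives onto `w`
  have h1 : |∫ x, ‖w x‖ * ⟪w x, Torus.convect u u x⟫| ≤ 2 * ∫ x, ‖u x‖ ^ 2 * (‖w x‖ * G x) :=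
    abs_integral_norm_mul_inner_convect_le' hu hdiv hw
  -- ### Step 2: Cauchy–Schwarz `J ≤ X^{1/2} M4^{1/2}`
  set J : ℝ := ∫ x, ‖u x‖ ^ 2 * (‖w x‖ * G x) with hJ
  set M4 : ℝ := ∫ x, ‖u x‖ ^ 4 * ‖w x‖ with hM4
  have hM40 : 0 ≤ M4 := integral_nonneg fun x => mul_nonneg (pow_nonneg (norm_nonneg _) 4) (norm_nonneg _)
  have hJle : J ≤ X ^ (1 / 2 : ℝ) * M4 ^ (1 / 2 : ℝ) := by
    have hH := integral_mul_le_rpow_mul_rpow (f := fun x => Real.sqrt ‖w x‖ * G x)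
      (g := fun x => ‖u x‖ ^ 2 * Real.sqrt ‖w x‖) (hwc.norm.sqrt.mul hGc)
      ((huc.norm.pow 2).mul hwc.norm.sqrt) (fun x => mul_nonneg (Real.sqrt_nonneg _) (hG0 x))
      (fun x => mul_nonneg (sq_nonneg _) (Real.sqrt_nonneg _)) (a := 1 / 2) (b := 1 / 2)
      (by norm_num) (by norm_num) (by norm_num)
    have e0 : ∀ x, Real.sqrt ‖w x‖ * G x * (‖u x‖ ^ 2 * Real.sqrt ‖w x‖) =
        ‖u x‖ ^ 2 * (‖w x‖ * G x) := by
      intro x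
      have := Real.mul_self_sqrt (norm_nonneg (w x))
      calc Real.sqrt ‖w x‖ * G x * (‖u x‖ ^ 2 * Real.sqrt ‖w x‖)
          = (Real.sqrt ‖w x‖ * Real.sqrt ‖w x‖) * (‖u x‖ ^ 2 * G x) := by ring
        _ = ‖u x‖ ^ 2 * (‖w x‖ * G x) := by rw [this]; ring
    have e1 : ∀ x, (Real.sqrt ‖w x‖ * G x) ^ (1 / 2 : ℝ)⁻¹ =
        ‖w x‖ * ∑ k, ‖Torus.partialDeriv k w x‖ ^ 2 := by
      intro x
      rw [show (1 / 2 : ℝ)⁻¹ = 2 by norm_num, Real.rpow_two, mul_pow, Real.sq_sqrt (norm_nonneg _),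
        hG]
      simp only
      rw [Real.sq_sqrt (hSum0 x)]
    have e2 : ∀ x, (‖u x‖ ^ 2 * Real.sqrt ‖w x‖) ^ (1 / 2 : ℝ)⁻¹ = ‖u x‖ ^ 4 * ‖w x‖ := by
      intro x
      rw [show (1 / 2 : ℝ)⁻¹ = 2 by norm_num, Real.rpow_two, mul_pow, Real.sq_sqrt (norm_nonneg _)]
      ring
    simp only [e0, e1, e2] at hH
    exact hH
  -- ### Step 3: `|u|⁴ ≤ 8|v|⁴ + 8|w|⁴`, so `M4 ≤ 8 M4v + 8 W5`
  set M4v : ℝ := ∫ x, ‖v x‖ ^ 4 * ‖w x‖ with hM4v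
  set W5 : ℝ := ∫ x, ‖w x‖ ^ 5 with hW5
  have hM4le : M4 ≤ 8 * M4v + 8 * W5 := by
    have hpt : ∀ x, ‖u x‖ ^ 4 * ‖w x‖ ≤ 8 * (‖v x‖ ^ 4 * ‖w x‖) + 8 * ‖w x‖ ^ 5 := by
      intro x
      have hu' : u x = v x + w x := by simp [hwdef]
      have hn : ‖u x‖ ≤ ‖v x‖ + ‖w x‖ := by rw [hu']; exact norm_add_le _ _
      have h4 : ‖u x‖ ^ 4 ≤ (‖v x‖ + ‖w x‖) ^ 4 :=
        pow_le_pow_left₀ (norm_nonneg _) hn 4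
      have h8 := add_pow_four_le ‖v x‖ ‖w x‖
      have hw0' : 0 ≤ ‖w x‖ := norm_nonneg _
      calc ‖u x‖ ^ 4 * ‖w x‖ ≤ 8 * (‖v x‖ ^ 4 + ‖w x‖ ^ 4) * ‖w x‖ :=
            mul_le_mul_of_nonneg_right (h4.trans h8) hw0'
        _ = 8 * (‖v x‖ ^ 4 * ‖w x‖) + 8 * ‖w x‖ ^ 5 := by ring
    have hi1 : Integrable (fun x => ‖u x‖ ^ 4 * ‖w x‖) volume :=
      ((huc.norm.pow 4).mul hwc.norm).integrable_unitAddTorus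
    have hia : Integrable (fun x => ‖v x‖ ^ 4 * ‖w x‖) volume :=
      ((hvc.norm.pow 4).mul hwc.norm).integrable_unitAddTorus
    have hib : Integrable (fun x => ‖w x‖ ^ 5) volume := (hwc.norm.pow 5).integrable_unitAddTorus
    have hi2 : Integrable (fun x => 8 * (‖v x‖ ^ 4 * ‖w x‖) + 8 * ‖w x‖ ^ 5) volume :=
      (hia.const_mul 8).add (hib.const_mul 8)
    have := integral_mono hi1 hi2 hpt
    rw [integral_add (hia.const_mul 8) (hib.const_mul 8), integral_const_mul,
      integral_const_mul] at this
    exact this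
  -- ### Step 4: `W5 ≤ U^{2/3} (cX)` and `M4v ≤ M (cX)^{1/3}`
  have hW5 : W5 ≤ U ^ (2 / 3 : ℝ) * (c * X) := by
    have h := integral_norm_pow_five_le hwc
    exact h.trans (mul_le_mul_of_nonneg_left hL2w (Real.rpow_nonneg hU0 _))
  have hM4v : M4v ≤ M * (c * X) ^ (1 / 3 : ℝ) := by
    have hH := integral_mul_le_rpow_mul_rpow (f := fun x => ‖v x‖ ^ 4) (g := fun x => ‖w x‖)
      (hvc.norm.pow 4) hwc.norm (fun x => pow_nonneg (norm_nonneg _) 4) (fun x => norm_nonneg _)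
      (a := 8 / 9) (b := 1 / 9) (by norm_num) (by norm_num) (by norm_num)
    have e1 : ∀ x, (‖v x‖ ^ 4) ^ (8 / 9 : ℝ)⁻¹ = ‖v x‖ ^ (9 / 2 : ℝ) := by
      intro x
      rw [← Real.rpow_natCast, ← Real.rpow_mul (norm_nonneg _)]
      norm_num
    have e2 : ∀ x, ‖w x‖ ^ (1 / 9 : ℝ)⁻¹ = ‖w x‖ ^ (9 : ℝ) := by
      intro x; norm_num
    simp only [e1, e2] at hH
    exact hH.trans (mul_le_mul_of_nonneg_left hL hM0)
  -- ### Step 5: `J ≤ kF/6 · M^{1/2} X^{2/3} + (8c)^{1/2} U^{1/3} X`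
  have hJ2 : J ≤ (8 * c ^ (1 / 3 : ℝ)) ^ (1 / 2 : ℝ) * M ^ (1 / 2 : ℝ) * X ^ (2 / 3 : ℝ) +
      (8 * c) ^ (1 / 2 : ℝ) * U ^ (1 / 3 : ℝ) * X := by
    -- `M4 ≤ 8 M c^{1/3} X^{1/3} + 8 c U^{2/3} X`
    have hcX13 : (c * X) ^ (1 / 3 : ℝ) = c ^ (1 / 3 : ℝ) * X ^ (1 / 3 : ℝ) :=
      Real.mul_rpow hc0 hX0
    have hM4' : M4 ≤ 8 * M * c ^ (1 / 3 : ℝ) * X ^ (1 / 3 : ℝ) + 8 * c * U ^ (2 / 3 : ℝ) * X := by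
      calc M4 ≤ 8 * M4v + 8 * W5 := hM4le
        _ ≤ 8 * (M * (c * X) ^ (1 / 3 : ℝ)) + 8 * (U ^ (2 / 3 : ℝ) * (c * X)) := by
            gcongr
        _ = 8 * M * c ^ (1 / 3 : ℝ) * X ^ (1 / 3 : ℝ) + 8 * c * U ^ (2 / 3 : ℝ) * X := by
            rw [hcX13]; ring
    have hA0 : 0 ≤ 8 * M * c ^ (1 / 3 : ℝ) * X ^ (1 / 3 : ℝ) := by positivity
    have hA'0 : 0 ≤ 8 * c * U ^ (2 / 3 : ℝ) * X := by positivity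
    -- `M4^{1/2} ≤ (8Mc^{1/3}X^{1/3})^{1/2} + (8cU^{2/3}X)^{1/2}`
    have hsqrt : M4 ^ (1 / 2 : ℝ) ≤ (8 * M * c ^ (1 / 3 : ℝ) * X ^ (1 / 3 : ℝ)) ^ (1 / 2 : ℝ) +
        (8 * c * U ^ (2 / 3 : ℝ) * X) ^ (1 / 2 : ℝ) :=
      (Real.rpow_le_rpow hM40 hM4' (by norm_num)).trans
        (add_rpow_le_add_rpow hA0 hA'0 (by norm_num) (by norm_num))
    -- the two products with `X^{1/2}`
    have e1 : X ^ (1 / 2 : ℝ) * (8 * M * c ^ (1 / 3 : ℝ) * X ^ (1 / 3 : ℝ)) ^ (1 / 2 : ℝ) =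
        (8 * c ^ (1 / 3 : ℝ)) ^ (1 / 2 : ℝ) * M ^ (1 / 2 : ℝ) * X ^ (2 / 3 : ℝ) := by
      rw [show 8 * M * c ^ (1 / 3 : ℝ) * X ^ (1 / 3 : ℝ) =
          (8 * c ^ (1 / 3 : ℝ)) * M * X ^ (1 / 3 : ℝ) by ring,
        Real.mul_rpow (by positivity) (Real.rpow_nonneg hX0 _),
        Real.mul_rpow (by positivity) hM0, ← Real.rpow_mul hX0]
      have e : X ^ (1 / 2 : ℝ) * X ^ ((1 / 3 : ℝ) * (1 / 2)) = X ^ (2 / 3 : ℝ) := by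
        rw [← Real.rpow_add' hX0 (by norm_num)]; norm_num
      calc X ^ (1 / 2 : ℝ) * ((8 * c ^ (1 / 3 : ℝ)) ^ (1 / 2 : ℝ) * M ^ (1 / 2 : ℝ) *
            X ^ ((1 / 3 : ℝ) * (1 / 2)))
          = (8 * c ^ (1 / 3 : ℝ)) ^ (1 / 2 : ℝ) * M ^ (1 / 2 : ℝ) *
              (X ^ (1 / 2 : ℝ) * X ^ ((1 / 3 : ℝ) * (1 / 2))) := by ring
        _ = _ := by rw [e]
    have e2 : X ^ (1 / 2 : ℝ) * (8 * c * U ^ (2 / 3 : ℝ) * X) ^ (1 / 2 : ℝ) =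
        (8 * c) ^ (1 / 2 : ℝ) * U ^ (1 / 3 : ℝ) * X := by
      rw [show 8 * c * U ^ (2 / 3 : ℝ) * X = (8 * c) * U ^ (2 / 3 : ℝ) * X by ring,
        Real.mul_rpow (by positivity) hX0,
        Real.mul_rpow (by positivity) (Real.rpow_nonneg hU0 _), ← Real.rpow_mul hU0]
      have e : X ^ (1 / 2 : ℝ) * X ^ (1 / 2 : ℝ) = X := by
        rw [← Real.rpow_add' hX0 (by norm_num)]; norm_num
      calc X ^ (1 / 2 : ℝ) * ((8 * c) ^ (1 / 2 : ℝ) * U ^ ((2 / 3 : ℝ) * (1 / 2)) * X ^ (1 / 2 : ℝ))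
          = (8 * c) ^ (1 / 2 : ℝ) * U ^ ((2 / 3 : ℝ) * (1 / 2)) *
              (X ^ (1 / 2 : ℝ) * X ^ (1 / 2 : ℝ)) := by ring
        _ = (8 * c) ^ (1 / 2 : ℝ) * U ^ (1 / 3 : ℝ) * X := by rw [e]; norm_num
    calc J ≤ X ^ (1 / 2 : ℝ) * M4 ^ (1 / 2 : ℝ) := hJle
      _ ≤ X ^ (1 / 2 : ℝ) * ((8 * M * c ^ (1 / 3 : ℝ) * X ^ (1 / 3 : ℝ)) ^ (1 / 2 : ℝ) +
            (8 * c * U ^ (2 / 3 : ℝ) * X) ^ (1 / 2 : ℝ)) :=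
          mul_le_mul_of_nonneg_left hsqrt (Real.rpow_nonneg hX0 _)
      _ = _ := by rw [mul_add, e1, e2]
  -- ### Step 6: Young on the `X^{2/3}` term and `M^{3/2} ≤ c Uv Xv`
  have hM32 : M ^ (3 / 2 : ℝ) ≤ c * Uv * Xv := by
    have h := rpow_L92_three_halves_le hvc
    calc M ^ (3 / 2 : ℝ) ≤ Uv * Bv ^ (1 / 3 : ℝ) := h
      _ ≤ Uv * (c * Xv) := mul_le_mul_of_nonneg_left hL2v hUv0
      _ = c * Uv * Xv := by ring
  have hyoung : kF * M ^ (1 / 2 : ℝ) * X ^ (2 / 3 : ℝ) ≤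
      ν / 4 * X + 64 / 27 * ν⁻¹ ^ 2 * (kF * M ^ (1 / 2 : ℝ)) ^ 3 :=
    young_two_thirds hX0 (mul_nonneg hkF0 (Real.rpow_nonneg hM0 _)) hν
  have hy3 : (kF * M ^ (1 / 2 : ℝ)) ^ 3 ≤ kF ^ 3 * (c * Uv * Xv) := by
    rw [mul_pow]
    refine mul_le_mul_of_nonneg_left ?_ (pow_nonneg hkF0 3)
    have e : (M ^ (1 / 2 : ℝ)) ^ 3 = M ^ (3 / 2 : ℝ) := by
      rw [← Real.rpow_natCast, ← Real.rpow_mul hM0]; norm_num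
    rw [e]; exact hM32
  -- ### assemble
  have h3J : 3 * |∫ x, ‖w x‖ * ⟪w x, Torus.convect u u x⟫| ≤ 6 * J := by linarith [h1]
  have hkF' : 6 * ((8 * c ^ (1 / 3 : ℝ)) ^ (1 / 2 : ℝ) * M ^ (1 / 2 : ℝ) * X ^ (2 / 3 : ℝ)) =
      kF * M ^ (1 / 2 : ℝ) * X ^ (2 / 3 : ℝ) := by rw [hkF]; ring
  have hν2 : 0 ≤ ν⁻¹ ^ 2 := sq_nonneg _
  calc 3 * |∫ x, ‖w x‖ * ⟪w x, Torus.convect u u x⟫| ≤ 6 * J := h3J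
    _ ≤ 6 * ((8 * c ^ (1 / 3 : ℝ)) ^ (1 / 2 : ℝ) * M ^ (1 / 2 : ℝ) * X ^ (2 / 3 : ℝ)) +
          6 * ((8 * c) ^ (1 / 2 : ℝ) * U ^ (1 / 3 : ℝ) * X) := by linarith [hJ2]
    _ = kF * M ^ (1 / 2 : ℝ) * X ^ (2 / 3 : ℝ) + 6 * (8 * c) ^ (1 / 2 : ℝ) * U ^ (1 / 3 : ℝ) * X := by
          rw [hkF']; ring
    _ ≤ ν / 4 * X + 64 / 27 * ν⁻¹ ^ 2 * (kF ^ 3 * (c * Uv * Xv)) +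
          6 * (8 * c) ^ (1 / 2 : ℝ) * U ^ (1 / 3 : ℝ) * X := by
          have := mul_le_mul_of_nonneg_left hy3 (by positivity : (0 : ℝ) ≤ 64 / 27 * ν⁻¹ ^ 2)
          linarith [hyoung]
    _ = ν / 4 * X + 6 * (8 * c) ^ (1 / 2 : ℝ) * U ^ (1 / 3 : ℝ) * X +
          64 / 27 * kF ^ 3 * c * ν⁻¹ ^ 2 * Uv * Xv := by ring


/-! ## 9. The pressure term of the remainder system (Robinson–Sadowski 2014, `R₃`) -/

/-- **The term `R₃`.** There are `K₁, K₃ ≥ 0` (depending on `d`) such that along every classical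
solution `(u, p)` of the unforced system on `[a, b] × T^d` (`card d = 3`, `ν > 0`), at every
`t ∈ [a, b]` and for every smooth mean-zero `v` with `w := u(t) − v` of zero mean,
`(3/(4ν)) ∫ (p − ⟨p⟩)² ‖w‖ ≤ (ν/4) X + K₁ ν⁻¹ (∫‖w‖³)^{2/3} X + K₃ ν⁻² (∫‖v‖³) X_v`
(`X = ∫‖w‖∑ₖ‖∂ₖw‖²`, `X_v = ∫‖v‖∑ₖ‖∂ₖv‖²`) — Hölder `(9/8, 9)`, the Calderón–Zygmund bound
`‖p − ⟨p⟩‖_{L^{9/4}} ≤ C‖u‖²_{L^{9/2}}` (Lemma 3; tree `Torus.exists_pressure_sub_average_Ls_le_normSq`),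
`|u|^{9/2} ≤ 2^{7/2}(|v|^{9/2} + |w|^{9/2})`, the interpolations `‖·‖_{9/2} ≤ ‖·‖₃^{1/2}‖·‖₉^{1/2}`,
Lemma 2 and Young, with the viscosity restored.
[cite: RobinsonSadowski2014, Theorem 5 (proof, p. 171) and Lemma 3 (p. 167)] -/
theorem exists_pressure_bound (hd : Fintype.card d = 3) :
    ∃ K₁ K₃ : ℝ, 0 ≤ K₁ ∧ 0 ≤ K₃ ∧ ∀ {ν a b : ℝ}, 0 < ν → a < b →
      ∀ {u : ℝ → UnitAddTorus d → EuclideanSpace ℝ d} {p : ℝ → UnitAddTorus d → ℝ},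
        Torus.IsClassicalNSSolutionOn (Icc a b) ν 0 u p → ∀ {t : ℝ}, t ∈ Icc a b →
        ∀ {v : UnitAddTorus d → EuclideanSpace ℝ d}, Torus.IsSmooth v → Torus.HasZeroMean v →
          Torus.HasZeroMean (fun y => u t y - v y) →
          3 / 4 * ν⁻¹ * ∫ x, (p t x - ∫ y, p t y) ^ 2 * ‖u t x - v x‖ ≤
            ν / 4 * (∫ x, ‖u t x - v x‖ * ∑ k, ‖Torus.partialDeriv k (fun y => u t y - v y) x‖ ^ 2) +
            K₁ * ν⁻¹ * (∫ x, ‖u t x - v x‖ ^ (3 : ℝ)) ^ (2 / 3 : ℝ) *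
              (∫ x, ‖u t x - v x‖ * ∑ k, ‖Torus.partialDeriv k (fun y => u t y - v y) x‖ ^ 2) +
            K₃ * ν⁻¹ ^ 2 * (∫ x, ‖v x‖ ^ (3 : ℝ)) *
              (∫ x, ‖v x‖ * ∑ k, ‖Torus.partialDeriv k v x‖ ^ 2) := by
  haveI : Nonempty d := by rw [← Fintype.card_pos_iff, hd]; norm_num
  obtain ⟨CP, hCP0, hCP⟩ :=
    Torus.exists_pressure_sub_average_Ls_le_normSq (d := d) (γ := 9 / 4) (by norm_num)
  obtain ⟨c, hc0, hc⟩ := exists_L9_cube_le_weightedDissipation (d := d) hd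
  set K₀ : ℝ := 3 / 4 * CP ^ 2 * (2 : ℝ) ^ (28 / 9 : ℝ) * c ^ (1 / 3 : ℝ) with hK₀
  have hK₀0 : 0 ≤ K₀ := by rw [hK₀]; positivity
  refine ⟨3 / 4 * CP ^ 2 * (2 : ℝ) ^ (28 / 9 : ℝ) * c, K₀ ^ (3 / 2 : ℝ) * c, by positivity,
    by positivity, fun {ν a b} hν hab {u p} h {t} ht {v} hv hv0 hw0 => ?_⟩
  -- notation
  set w : UnitAddTorus d → EuclideanSpace ℝ d := fun y => u t y - v y with hwdef
  have hut : Torus.IsSmooth (u t) := h.smooth_velocity.isSmooth_slice ht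
  have hpt : Torus.IsSmooth (p t) := h.smooth_pressure.isSmooth_slice ht
  have hw : Torus.IsSmooth w := hut.sub hv
  have hwc : Continuous w := hw.continuous
  have huc : Continuous (u t) := hut.continuous
  have hvc : Continuous v := hv.continuous
  set c₀ : ℝ := ∫ y, p t y with hc₀
  have hπc : Continuous fun x => p t x - c₀ := hpt.continuous.sub continuous_const
  have hSum0 : ∀ x, 0 ≤ ∑ k, ‖Torus.partialDeriv k w x‖ ^ 2 := fun x =>
    Finset.sum_nonneg fun k _ => sq_nonneg _
  set X : ℝ := ∫ x, ‖w x‖ * ∑ k, ‖Torus.partialDeriv k w x‖ ^ 2 with hX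
  set U : ℝ := ∫ x, ‖w x‖ ^ (3 : ℝ) with hU
  set B : ℝ := ∫ x, ‖w x‖ ^ (9 : ℝ) with hB
  set Aw : ℝ := ∫ x, ‖w x‖ ^ (9 / 2 : ℝ) with hAw
  set Xv : ℝ := ∫ x, ‖v x‖ * ∑ k, ‖Torus.partialDeriv k v x‖ ^ 2 with hXv
  set Uv : ℝ := ∫ x, ‖v x‖ ^ (3 : ℝ) with hUv
  set Bv : ℝ := ∫ x, ‖v x‖ ^ (9 : ℝ) with hBv
  set Av : ℝ := ∫ x, ‖v x‖ ^ (9 / 2 : ℝ) with hAv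
  set M : ℝ := Av ^ (8 / 9 : ℝ) with hM
  set Au : ℝ := ∫ x, ‖u t x‖ ^ (9 / 2 : ℝ) with hAu
  set Q : ℝ := ∫ x, |p t x - c₀| ^ (9 / 4 : ℝ) with hQ
  set P : ℝ := ∫ x, (p t x - c₀) ^ 2 * ‖w x‖ with hP
  have hX0 : 0 ≤ X := integral_nonneg fun x => mul_nonneg (norm_nonneg _) (hSum0 x)
  have hU0 : 0 ≤ U := integral_nonneg fun x => Real.rpow_nonneg (norm_nonneg _) _
  have hB0 : 0 ≤ B := integral_nonneg fun x => Real.rpow_nonneg (norm_nonneg _) _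
  have hAw0 : 0 ≤ Aw := integral_nonneg fun x => Real.rpow_nonneg (norm_nonneg _) _
  have hXv0 : 0 ≤ Xv := integral_nonneg fun x => mul_nonneg (norm_nonneg _)
    (Finset.sum_nonneg fun k _ => sq_nonneg _)
  have hUv0 : 0 ≤ Uv := integral_nonneg fun x => Real.rpow_nonneg (norm_nonneg _) _
  have hBv0 : 0 ≤ Bv := integral_nonneg fun x => Real.rpow_nonneg (norm_nonneg _) _
  have hAv0 : 0 ≤ Av := integral_nonneg fun x => Real.rpow_nonneg (norm_nonneg _) _
  have hM0 : 0 ≤ M := Real.rpow_nonneg hAv0 _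
  have hAu0 : 0 ≤ Au := integral_nonneg fun x => Real.rpow_nonneg (norm_nonneg _) _
  have hQ0 : 0 ≤ Q := integral_nonneg fun x => Real.rpow_nonneg (abs_nonneg _) _
  have hP0 : 0 ≤ P := integral_nonneg fun x => mul_nonneg (sq_nonneg _) (norm_nonneg _)
  -- Lemma 2 for `w` and `v`
  have hL2w : B ^ (1 / 3 : ℝ) ≤ c * X := hc w hw hw0
  have hL2v : Bv ^ (1 / 3 : ℝ) ≤ c * Xv := hc v hv hv0
  have hcX0 : 0 ≤ c * X := mul_nonneg hc0 hX0
  have hL : B ^ (1 / 9 : ℝ) ≤ (c * X) ^ (1 / 3 : ℝ) := by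
    have e : B ^ (1 / 9 : ℝ) = (B ^ (1 / 3 : ℝ)) ^ (1 / 3 : ℝ) := by
      rw [← Real.rpow_mul hB0]; norm_num
    rw [e]
    exact Real.rpow_le_rpow (Real.rpow_nonneg hB0 _) hL2w (by norm_num)
  -- ### Step 1 (Hölder `(9/8, 9)`): `P ≤ Q^{8/9} B^{1/9}`
  have hP_le : P ≤ Q ^ (8 / 9 : ℝ) * B ^ (1 / 9 : ℝ) := by
    have hH := integral_mul_le_rpow_mul_rpow (f := fun x => (p t x - c₀) ^ 2)
      (g := fun x => ‖w x‖) (hπc.pow 2) hwc.norm (fun x => sq_nonneg _) (fun x => norm_nonneg _)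
      (a := 8 / 9) (b := 1 / 9) (by norm_num) (by norm_num) (by norm_num)
    have e1 : ∀ x, ((p t x - c₀) ^ 2) ^ (8 / 9 : ℝ)⁻¹ = |p t x - c₀| ^ (9 / 4 : ℝ) := by
      intro x
      rw [← sq_abs, ← Real.rpow_natCast, ← Real.rpow_mul (abs_nonneg _)]
      norm_num
    have e2 : ∀ x, ‖w x‖ ^ (1 / 9 : ℝ)⁻¹ = ‖w x‖ ^ (9 : ℝ) := by intro x; norm_num
    simp only [e1, e2] at hH
    exact hH
  -- ### Step 2 (Calderón–Zygmund, Lemma 3): `Q^{8/9} ≤ CP² Au^{8/9}`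
  have hQ89 : Q ^ (8 / 9 : ℝ) ≤ CP ^ 2 * Au ^ (8 / 9 : ℝ) := by
    have hπ := hCP hab h t ht
    have e3 : ∀ x, (‖u t x‖ ^ 2) ^ (9 / 4 : ℝ) = ‖u t x‖ ^ (9 / 2 : ℝ) := by
      intro x; rw [← Real.rpow_natCast, ← Real.rpow_mul (norm_nonneg _)]; norm_num
    simp only [e3] at hπ
    -- `hπ : Q^{4/9} ≤ CP * Au^{4/9}`
    have e4 : (1 : ℝ) / (9 / 4) = 4 / 9 := by norm_num
    rw [e4] at hπ
    have hsq := pow_le_pow_left₀ (Real.rpow_nonneg hQ0 _) hπ 2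
    rw [← Real.rpow_natCast, ← Real.rpow_mul hQ0, mul_pow, ← Real.rpow_natCast (Au ^ _),
      ← Real.rpow_mul hAu0] at hsq
    norm_num at hsq
    exact hsq
  -- ### Step 3: `Au ≤ 2^{7/2} (Av + Aw)` and `Au^{8/9} ≤ 2^{28/9} (M + Aw^{8/9})`
  have hAu_le : Au ≤ (2 : ℝ) ^ (7 / 2 : ℝ) * (Av + Aw) := by
    have hpt' : ∀ x, ‖u t x‖ ^ (9 / 2 : ℝ) ≤
        (2 : ℝ) ^ (7 / 2 : ℝ) * ‖v x‖ ^ (9 / 2 : ℝ) + (2 : ℝ) ^ (7 / 2 : ℝ) * ‖w x‖ ^ (9 / 2 : ℝ) := by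
      intro x
      have hu' : u t x = v x + w x := by simp [hwdef]
      have hn : ‖u t x‖ ≤ ‖v x‖ + ‖w x‖ := by rw [hu']; exact norm_add_le _ _
      have h1 : ‖u t x‖ ^ (9 / 2 : ℝ) ≤ (‖v x‖ + ‖w x‖) ^ (9 / 2 : ℝ) :=
        Real.rpow_le_rpow (norm_nonneg _) hn (by norm_num)
      have h2 := add_rpow_le_two_rpow_mul (norm_nonneg (v x)) (norm_nonneg (w x))
        (by norm_num : (1 : ℝ) ≤ 9 / 2)
      rw [show (9 / 2 : ℝ) - 1 = 7 / 2 by norm_num] at h2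
      calc ‖u t x‖ ^ (9 / 2 : ℝ) ≤ (‖v x‖ + ‖w x‖) ^ (9 / 2 : ℝ) := h1
        _ ≤ (2 : ℝ) ^ (7 / 2 : ℝ) * (‖v x‖ ^ (9 / 2 : ℝ) + ‖w x‖ ^ (9 / 2 : ℝ)) := h2
        _ = _ := by ring
    have hia : Integrable (fun x => ‖v x‖ ^ (9 / 2 : ℝ)) volume :=
      (hvc.norm.rpow_const fun x => Or.inr (by norm_num)).integrable_unitAddTorus
    have hib : Integrable (fun x => ‖w x‖ ^ (9 / 2 : ℝ)) volume :=
      (hwc.norm.rpow_const fun x => Or.inr (by norm_num)).integrable_unitAddTorus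
    have hi1 : Integrable (fun x => ‖u t x‖ ^ (9 / 2 : ℝ)) volume :=
      (huc.norm.rpow_const fun x => Or.inr (by norm_num)).integrable_unitAddTorus
    have hi2 : Integrable (fun x => (2 : ℝ) ^ (7 / 2 : ℝ) * ‖v x‖ ^ (9 / 2 : ℝ) +
        (2 : ℝ) ^ (7 / 2 : ℝ) * ‖w x‖ ^ (9 / 2 : ℝ)) volume :=
      (hia.const_mul _).add (hib.const_mul _)
    have := integral_mono hi1 hi2 hpt'
    rw [integral_add (hia.const_mul _) (hib.const_mul _), integral_const_mul,
      integral_const_mul] at this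
    calc Au ≤ (2 : ℝ) ^ (7 / 2 : ℝ) * Av + (2 : ℝ) ^ (7 / 2 : ℝ) * Aw := this
      _ = (2 : ℝ) ^ (7 / 2 : ℝ) * (Av + Aw) := by ring
  have hAu89 : Au ^ (8 / 9 : ℝ) ≤ (2 : ℝ) ^ (28 / 9 : ℝ) * (M + Aw ^ (8 / 9 : ℝ)) := by
    have h2pos : (0 : ℝ) ≤ (2 : ℝ) ^ (7 / 2 : ℝ) := by positivity
    have h1 := Real.rpow_le_rpow hAu0 hAu_le (by norm_num : (0 : ℝ) ≤ 8 / 9)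
    rw [Real.mul_rpow h2pos (add_nonneg hAv0 hAw0), ← Real.rpow_mul (by norm_num : (0:ℝ) ≤ 2)]
      at h1
    have h2 := add_rpow_le_add_rpow hAv0 hAw0 (by norm_num : (0 : ℝ) ≤ 8 / 9) (by norm_num)
    have e : (7 / 2 : ℝ) * (8 / 9) = 28 / 9 := by norm_num
    rw [e] at h1
    calc Au ^ (8 / 9 : ℝ) ≤ (2 : ℝ) ^ (28 / 9 : ℝ) * (Av + Aw) ^ (8 / 9 : ℝ) := h1
      _ ≤ (2 : ℝ) ^ (28 / 9 : ℝ) * (Av ^ (8 / 9 : ℝ) + Aw ^ (8 / 9 : ℝ)) :=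
          mul_le_mul_of_nonneg_left h2 (by positivity)
      _ = (2 : ℝ) ^ (28 / 9 : ℝ) * (M + Aw ^ (8 / 9 : ℝ)) := by rw [hM]
  -- `Aw^{8/9} ≤ U^{2/3} (cX)^{2/3}`
  have hAw89 : Aw ^ (8 / 9 : ℝ) ≤ U ^ (2 / 3 : ℝ) * (c * X) ^ (2 / 3 : ℝ) := by
    have h1 := rpow_L92_le hwc
    calc Aw ^ (8 / 9 : ℝ) ≤ U ^ (2 / 3 : ℝ) * (B ^ (1 / 3 : ℝ)) ^ (2 / 3 : ℝ) := h1
      _ ≤ U ^ (2 / 3 : ℝ) * (c * X) ^ (2 / 3 : ℝ) :=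
          mul_le_mul_of_nonneg_left (Real.rpow_le_rpow (Real.rpow_nonneg hB0 _) hL2w (by norm_num))
            (Real.rpow_nonneg hU0 _)
  -- ### Step 4: assemble `P ≤ CP² 2^{28/9} (M (cX)^{1/3} + U^{2/3} cX)`
  set K' : ℝ := CP ^ 2 * (2 : ℝ) ^ (28 / 9 : ℝ) with hK'
  have hK'0 : 0 ≤ K' := by rw [hK']; positivity
  have hP2 : P ≤ K' * M * (c * X) ^ (1 / 3 : ℝ) + K' * c * U ^ (2 / 3 : ℝ) * X := by
    have h1 : Q ^ (8 / 9 : ℝ) ≤ K' * (M + U ^ (2 / 3 : ℝ) * (c * X) ^ (2 / 3 : ℝ)) := by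
      calc Q ^ (8 / 9 : ℝ) ≤ CP ^ 2 * Au ^ (8 / 9 : ℝ) := hQ89
        _ ≤ CP ^ 2 * ((2 : ℝ) ^ (28 / 9 : ℝ) * (M + Aw ^ (8 / 9 : ℝ))) :=
            mul_le_mul_of_nonneg_left hAu89 (sq_nonneg _)
        _ ≤ CP ^ 2 * ((2 : ℝ) ^ (28 / 9 : ℝ) * (M + U ^ (2 / 3 : ℝ) * (c * X) ^ (2 / 3 : ℝ))) := by
            gcongr
        _ = K' * (M + U ^ (2 / 3 : ℝ) * (c * X) ^ (2 / 3 : ℝ)) := by rw [hK']; ring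
    have e23 : (c * X) ^ (2 / 3 : ℝ) * (c * X) ^ (1 / 3 : ℝ) = c * X := by
      rw [← Real.rpow_add' hcX0 (by norm_num)]; norm_num
    calc P ≤ Q ^ (8 / 9 : ℝ) * B ^ (1 / 9 : ℝ) := hP_le
      _ ≤ K' * (M + U ^ (2 / 3 : ℝ) * (c * X) ^ (2 / 3 : ℝ)) * (c * X) ^ (1 / 3 : ℝ) :=
          mul_le_mul h1 hL (Real.rpow_nonneg hB0 _)
            (mul_nonneg hK'0 (add_nonneg hM0 (by positivity)))
      _ = K' * M * (c * X) ^ (1 / 3 : ℝ) +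
            K' * U ^ (2 / 3 : ℝ) * ((c * X) ^ (2 / 3 : ℝ) * (c * X) ^ (1 / 3 : ℝ)) := by ring
      _ = K' * M * (c * X) ^ (1 / 3 : ℝ) + K' * c * U ^ (2 / 3 : ℝ) * X := by rw [e23]; ring
  -- ### Step 5: Young on the `X^{1/3}` term, `M^{3/2} ≤ c Uv Xv`
  have hcX13 : (c * X) ^ (1 / 3 : ℝ) = c ^ (1 / 3 : ℝ) * X ^ (1 / 3 : ℝ) := Real.mul_rpow hc0 hX0
  have hM32 : M ^ (3 / 2 : ℝ) ≤ c * Uv * Xv := by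
    have h1 := rpow_L92_three_halves_le hvc
    calc M ^ (3 / 2 : ℝ) ≤ Uv * Bv ^ (1 / 3 : ℝ) := h1
      _ ≤ Uv * (c * Xv) := mul_le_mul_of_nonneg_left hL2v hUv0
      _ = c * Uv * Xv := by ring
  -- `y = K₀ ν⁻¹ M`
  have hy0 : 0 ≤ K₀ * ν⁻¹ * M := by positivity
  have hyoung : K₀ * ν⁻¹ * M * X ^ (1 / 3 : ℝ) ≤
      ν / 4 * X + ν ^ (-(1 / 2 : ℝ)) * (K₀ * ν⁻¹ * M) ^ (3 / 2 : ℝ) :=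
    young_cube_root hX0 hy0 hν
  have hy32 : ν ^ (-(1 / 2 : ℝ)) * (K₀ * ν⁻¹ * M) ^ (3 / 2 : ℝ) ≤
      K₀ ^ (3 / 2 : ℝ) * c * ν⁻¹ ^ 2 * Uv * Xv := by
    rw [Real.mul_rpow (mul_nonneg hK₀0 (inv_nonneg.2 hν.le)) hM0,
      Real.mul_rpow hK₀0 (inv_nonneg.2 hν.le)]
    have e : ν ^ (-(1 / 2 : ℝ)) * (K₀ ^ (3 / 2 : ℝ) * ν⁻¹ ^ (3 / 2 : ℝ) * M ^ (3 / 2 : ℝ)) =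
        K₀ ^ (3 / 2 : ℝ) * (ν ^ (-(1 / 2 : ℝ)) * ν⁻¹ ^ (3 / 2 : ℝ)) * M ^ (3 / 2 : ℝ) := by ring
    rw [e, rpow_neg_half_mul_inv_rpow_three_halves hν]
    have h0 : 0 ≤ K₀ ^ (3 / 2 : ℝ) * ν⁻¹ ^ 2 := by positivity
    calc K₀ ^ (3 / 2 : ℝ) * ν⁻¹ ^ 2 * M ^ (3 / 2 : ℝ) ≤ K₀ ^ (3 / 2 : ℝ) * ν⁻¹ ^ 2 * (c * Uv * Xv) :=
          mul_le_mul_of_nonneg_left hM32 h0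
      _ = K₀ ^ (3 / 2 : ℝ) * c * ν⁻¹ ^ 2 * Uv * Xv := by ring
  -- ### assemble
  have hν0 : 0 ≤ ν⁻¹ := inv_nonneg.2 hν.le
  calc 3 / 4 * ν⁻¹ * P ≤ 3 / 4 * ν⁻¹ * (K' * M * (c * X) ^ (1 / 3 : ℝ) + K' * c * U ^ (2 / 3 : ℝ) * X) :=
        mul_le_mul_of_nonneg_left hP2 (by positivity)
    _ = K₀ * ν⁻¹ * M * X ^ (1 / 3 : ℝ) + 3 / 4 * CP ^ 2 * (2 : ℝ) ^ (28 / 9 : ℝ) * c * ν⁻¹ *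
          U ^ (2 / 3 : ℝ) * X := by rw [hcX13, hK₀, hK']; ring
    _ ≤ ν / 4 * X + K₀ ^ (3 / 2 : ℝ) * c * ν⁻¹ ^ 2 * Uv * Xv + 3 / 4 * CP ^ 2 * (2 : ℝ) ^ (28 / 9 : ℝ) * c *
          ν⁻¹ * U ^ (2 / 3 : ℝ) * X := by linarith [hyoung, hy32]
    _ = _ := by ring


/-! ## 10. The `L³` inequality of the remainder (Robinson–Sadowski 2014, (7)) -/

omit [DecidableEq d] in
/-- The heat equation restricts to sub-time-sets with unique derivatives. [folklore] -/
private theorem heat_mono {S S' : Set ℝ} {ν : ℝ} {v : ℝ → UnitAddTorus d → EuclideanSpace ℝ d}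
    (hv : Torus.IsSmoothSpaceTimeOn S v)
    (hheat : ∀ t ∈ S, ∀ x, Torus.timeDerivWithin S v t x = ν • Torus.laplacian (v t) x)
    (hS' : S' ⊆ S) (hU : UniqueDiffOn ℝ S') :
    ∀ t ∈ S', ∀ x, Torus.timeDerivWithin S' v t x = ν • Torus.laplacian (v t) x := by
  intro t ht x
  have h := ((hv.hasDerivWithinAt_slice (hS' ht) x).mono hS').derivWithin (hU t ht)
  unfold Torus.timeDerivWithin at h ⊢
  rw [h]
  exact hheat t (hS' ht) x

omit [DecidableEq d] in
/-- Zero mean of a difference of continuous zero-mean fields. [folklore] -/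
private theorem hasZeroMean_sub {u v : UnitAddTorus d → EuclideanSpace ℝ d} (hu : Continuous u)
    (hv : Continuous v) (hu0 : Torus.HasZeroMean u) (hv0 : Torus.HasZeroMean v) :
    Torus.HasZeroMean (fun y => u y - v y) := by
  unfold Torus.HasZeroMean at *
  rw [integral_sub hu.integrable_unitAddTorus hv.integrable_unitAddTorus, hu0, hv0, sub_zero]

/-- **Robinson–Sadowski 2014, (7), with the viscosity restored.** There are `K₁, K₂, K₃ ≥ 0`
(depending on `d`) such that: along every classical mean-zero solution `(u, p)` of the unforced
Navier–Stokes system on `[a, b] × T^d` (`card d = 3`, `ν > 0`) and every jointly smooth solution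
`v` of `∂ₜv = νΔv` on `[a, b]` with divergence-free mean-zero slices, the remainder `w = u − v`
satisfies, for every one-sided derivative `R` of `s ↦ ∫‖w(s)‖³` within `[a, b]` at `t`,
`R ≤ −(5/2)ν X + K₁ ν⁻¹ U^{2/3} X + K₂ U^{1/3} X + K₃ ν⁻² U_v X_v`,
`U = ∫‖w‖³`, `X = ∫‖w‖∑ₖ‖∂ₖw‖²`, `U_v = ∫‖v‖³`, `X_v = ∫‖v‖∑ₖ‖∂ₖv‖²` (printed, `ν = 1`:
`d/dt‖w‖³_{L³} + I(w) ≤ c‖w‖³_{L³}I(w) + c‖v‖³_{L³}I(v)`; here the cubic terms are kept in the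
form in which they arise, before the last Young step). The `L³` balance of the forced remainder
system (RRS (11.19), tree `deriv_integral_normSq_rpow_le_of_two_le`), the vanishing transport term,
`exists_convective_bound` and `exists_pressure_bound`.
[cite: RobinsonSadowski2014, Theorem 5 (proof, eq. (7) p. 162 and pp. 170–171)] -/
theorem exists_deriv_remainder_le (hd : Fintype.card d = 3) :
    ∃ K₁ K₂ K₃ : ℝ, 0 ≤ K₁ ∧ 0 ≤ K₂ ∧ 0 ≤ K₃ ∧ ∀ {ν a b : ℝ}, 0 < ν → a < b →
      ∀ {u v : ℝ → UnitAddTorus d → EuclideanSpace ℝ d} {p : ℝ → UnitAddTorus d → ℝ},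
        Torus.IsClassicalNSSolutionOn (Icc a b) ν 0 u p →
        (∀ t ∈ Icc a b, Torus.HasZeroMean (u t)) →
        Torus.IsSmoothSpaceTimeOn (Icc a b) v →
        (∀ t ∈ Icc a b, ∀ x, Torus.timeDerivWithin (Icc a b) v t x = ν • Torus.laplacian (v t) x) →
        (∀ t ∈ Icc a b, Torus.IsDivFree (v t)) → (∀ t ∈ Icc a b, Torus.HasZeroMean (v t)) →
        ∀ t ∈ Icc a b, ∀ R : ℝ,
          HasDerivWithinAt (fun s => ∫ x, ‖u s x - v s x‖ ^ (3 : ℝ)) R (Icc a b) t →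
          R ≤ -(5 / 2 * ν *
                (∫ x, ‖u t x - v t x‖ * ∑ k, ‖Torus.partialDeriv k (fun y => u t y - v t y) x‖ ^ 2)) +
            K₁ * ν⁻¹ * (∫ x, ‖u t x - v t x‖ ^ (3 : ℝ)) ^ (2 / 3 : ℝ) *
              (∫ x, ‖u t x - v t x‖ * ∑ k, ‖Torus.partialDeriv k (fun y => u t y - v t y) x‖ ^ 2) +
            K₂ * (∫ x, ‖u t x - v t x‖ ^ (3 : ℝ)) ^ (1 / 3 : ℝ) *
              (∫ x, ‖u t x - v t x‖ * ∑ k, ‖Torus.partialDeriv k (fun y => u t y - v t y) x‖ ^ 2) +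
            K₃ * ν⁻¹ ^ 2 * (∫ x, ‖v t x‖ ^ (3 : ℝ)) *
              (∫ x, ‖v t x‖ * ∑ k, ‖Torus.partialDeriv k (v t) x‖ ^ 2) := by
  obtain ⟨K₁, K₃P, hK₁0, hK₃P0, hP⟩ := exists_pressure_bound (d := d) hd
  obtain ⟨K₂, K₃F, hK₂0, hK₃F0, hF⟩ := exists_convective_bound (d := d) hd
  refine ⟨K₁, K₂, K₃P + K₃F, hK₁0, hK₂0, add_nonneg hK₃P0 hK₃F0,
    fun {ν a b} hν hab {u v p} h hmean hv hheat hdiv hvmean t ht R hR => ?_⟩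
  have hS : UniqueDiffOn ℝ (Icc a b) := uniqueDiffOn_Icc hab
  -- the remainder system, with the pressure normalised to zero mean at time `t`
  have hW := isClassicalNS_sub_heat hS h hv hheat hdiv
  set c₀ : ℝ := ∫ y, p t y with hc₀
  have hW' := pressure_sub_const hW c₀
  -- slices
  have hut : Torus.IsSmooth (u t) := h.smooth_velocity.isSmooth_slice ht
  have hvt : Torus.IsSmooth (v t) := hv.isSmooth_slice ht
  have hwt : Torus.IsSmooth (fun y => u t y - v t y) := hut.sub hvt
  have hwdiv : Torus.IsDivFree (fun y => u t y - v t y) := hW.divFree t ht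
  have hw0 : Torus.HasZeroMean (fun y => u t y - v t y) :=
    hasZeroMean_sub hut.continuous hvt.continuous (hmean t ht) (hvmean t ht)
  -- the `L³` balance of the remainder system
  have e_fun : (fun s => ∫ x, ‖u s x - v s x‖ ^ (3 : ℝ)) =
      fun s => ∫ x, (‖u s x - v s x‖ ^ 2) ^ ((3 : ℝ) / 2) := by
    funext s
    refine integral_congr_ae (ae_of_all _ fun x => ?_)
    show ‖u s x - v s x‖ ^ (3 : ℝ) = (‖u s x - v s x‖ ^ 2) ^ ((3 : ℝ) / 2)
    rw [← Real.rpow_natCast, ← Real.rpow_mul (norm_nonneg _)]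
    norm_num
  rw [e_fun] at hR
  have hbal := hW'.deriv_integral_normSq_rpow_le_of_two_le hν hab (α := 3) (by norm_num) ht hR
  have hpw : ∀ x, (‖u t x - v t x‖ ^ 2) ^ ((3 : ℝ) / 2 - 1) = ‖u t x - v t x‖ := by
    intro x
    rw [show (3 : ℝ) / 2 - 1 = 1 / 2 by norm_num]
    exact normSq_rpow_half _
  simp only [hpw] at hbal
  -- the forcing term: transport part vanishes, convective part bounded
  set X : ℝ := ∫ x, ‖u t x - v t x‖ *
    ∑ k, ‖Torus.partialDeriv k (fun y => u t y - v t y) x‖ ^ 2 with hX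
  have hforce : (∫ x, ‖u t x - v t x‖ *
      ⟪u t x - v t x, Torus.convect (fun y => u t y - v t y) (fun y => u t y - v t y) x -
        Torus.convect (u t) (u t) x⟫) =
      -∫ x, ‖u t x - v t x‖ * ⟪u t x - v t x, Torus.convect (u t) (u t) x⟫ := by
    have hc1 : Continuous fun x => ‖u t x - v t x‖ *
        ⟪u t x - v t x, Torus.convect (fun y => u t y - v t y) (fun y => u t y - v t y) x⟫ :=
      hwt.continuous.norm.mul (hwt.continuous.inner (hwt.convect hwt).continuous)
    have hc2 : Continuous fun x => ‖u t x - v t x‖ *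
        ⟪u t x - v t x, Torus.convect (u t) (u t) x⟫ :=
      hwt.continuous.norm.mul (hwt.continuous.inner (hut.convect hut).continuous)
    have htr := integral_norm_mul_inner_convect_self_eq_zero' hwt hwdiv
    simp only [inner_sub_right, mul_sub]
    rw [integral_sub hc1.integrable_unitAddTorus hc2.integrable_unitAddTorus]
    have htr' : (∫ x, ‖u t x - v t x‖ *
        ⟪u t x - v t x, Torus.convect (fun y => u t y - v t y) (fun y => u t y - v t y) x⟫) = 0 :=
      htr
    rw [htr', zero_sub]
  have hFb := hF hν hut hvt (h.divFree t ht) (hvmean t ht) hw0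
  have hPb := hP hν hab h ht hvt (hvmean t ht) hw0
  have habs : 3 * -(∫ x, ‖u t x - v t x‖ * ⟪u t x - v t x, Torus.convect (u t) (u t) x⟫) ≤
      3 * |∫ x, ‖u t x - v t x‖ * ⟪u t x - v t x, Torus.convect (u t) (u t) x⟫| := by
    have := neg_abs_le (∫ x, ‖u t x - v t x‖ * ⟪u t x - v t x, Torus.convect (u t) (u t) x⟫)
    linarith
  rw [hforce] at hbal
  have e34 : (3 : ℝ) / 2 * (3 / 2 - 1) / ν = 3 / 4 * ν⁻¹ := by
    rw [div_eq_mul_inv]; norm_num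
  rw [e34] at hbal
  -- combine
  have hX0 : 0 ≤ X := integral_nonneg fun x => mul_nonneg (norm_nonneg _)
    (Finset.sum_nonneg fun k _ => sq_nonneg _)
  nlinarith [hbal, hFb, hPb, habs, hX0, hν.le]

/-! ## 11. Trapping below a threshold with an integrable forcing (Robinson–Sadowski 2014, Lemma 4) -/

omit [Fintype d] [DecidableEq d] in
/-- **Trapping with forcing** (the role of Robinson–Sadowski's Lemma 4: `ẏ ≤ b − α x + c y x + f`,
`y(0) = 0`, `∫f` small ⇒ `y` stays small). If `U` and `P` have one-sided derivatives `U'`, `G`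
within `[0, t₁]`, `U 0 = 0 = P 0`, `P < M` on `[0, t₁]`, and `U' s ≤ G s` whenever `U s < M`, then
`U < M` on `[0, t₁]` (first hitting time: before it, `U − P` is non-increasing, so `U ≤ P < M` at
it). [cite: RobinsonSadowski2014, Lemma 4 (p. 167)] -/
theorem lt_of_deriv_le_forcing_below {U U' P G : ℝ → ℝ} {t₁ M : ℝ}
    (hder : ∀ s ∈ Icc 0 t₁, HasDerivWithinAt U (U' s) (Icc 0 t₁) s)
    (hPder : ∀ s ∈ Icc 0 t₁, HasDerivWithinAt P (G s) (Icc 0 t₁) s)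
    (h0 : U 0 = 0) (hP0 : P 0 = 0) (hPM : ∀ s ∈ Icc 0 t₁, P s < M)
    (hle : ∀ s ∈ Icc 0 t₁, U s < M → U' s ≤ G s) : ∀ s ∈ Icc 0 t₁, U s < M := by
  have hcont : ContinuousOn U (Icc 0 t₁) := fun s hs => (hder s hs).continuousWithinAt
  have hPcont : ContinuousOn P (Icc 0 t₁) := fun s hs => (hPder s hs).continuousWithinAt
  by_contra hnot
  obtain ⟨s₀, hs₀, hs₀M⟩ : ∃ s ∈ Icc 0 t₁, M ≤ U s := by
    simpa only [not_forall, not_lt, exists_prop] using hnot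
  set S : Set ℝ := Icc 0 t₁ ∩ U ⁻¹' Ici M with hS
  have hSne : S.Nonempty := ⟨s₀, hs₀, hs₀M⟩
  have hSclosed : IsClosed S := hcont.preimage_isClosed_of_isClosed isClosed_Icc isClosed_Ici
  have hSbdd : BddBelow S := ⟨0, fun s hs => hs.1.1⟩
  set tstar : ℝ := sInf S with htstar
  have htS : tstar ∈ S := hSclosed.csInf_mem hSne hSbdd
  have ht0 : 0 ≤ tstar := htS.1.1
  have htM : M ≤ U tstar := htS.2
  have hM0 : 0 < M := by have := hPM 0 ⟨le_rfl, hs₀.1.trans hs₀.2⟩; rw [hP0] at this; exact this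
  have hbefore : ∀ s ∈ Ico 0 tstar, U s < M := by
    intro s hs
    by_contra hsM
    have hsS : s ∈ S := ⟨⟨hs.1, hs.2.le.trans htS.1.2⟩, not_lt.1 hsM⟩
    exact absurd (csInf_le hSbdd hsS) (not_le.2 hs.2)
  have htpos : 0 < tstar := by
    rcases ht0.eq_or_lt with h | h
    · exfalso; rw [← h, h0] at htM; linarith
    · exact h
  -- `Φ = U − P` is non-increasing on `[0, s]` for every `s < t*`
  set Φ : ℝ → ℝ := fun s => U s - P s with hΦ
  have hanti : ∀ s ∈ Ico 0 tstar, Φ s ≤ Φ 0 := by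
    intro s hs
    rcases hs.1.eq_or_lt with h0s | h0s
    · rw [← h0s]
    have hsub : Icc 0 s ⊆ Icc 0 t₁ := Icc_subset_Icc le_rfl (hs.2.le.trans htS.1.2)
    have hderiv : ∀ r ∈ Icc 0 s, HasDerivWithinAt Φ (U' r - G r) (Icc 0 s) r := fun r hr =>
      ((hder r (hsub hr)).sub (hPder r (hsub hr))).mono hsub
    have hnonpos : ∀ r ∈ interior (Icc 0 s), U' r - G r ≤ 0 := by
      intro r hr
      rw [interior_Icc] at hr
      have := hle r (hsub ⟨hr.1.le, hr.2.le⟩) (hbefore r ⟨hr.1.le, hr.2.trans hs.2⟩)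
      linarith
    have hmono := antitoneOn_of_hasDerivWithinAt_nonpos (convex_Icc 0 s)
      (fun r hr => (hderiv r hr).continuousWithinAt)
      (fun r hr => (hderiv r (interior_subset hr)).mono interior_subset) hnonpos
    exact hmono ⟨le_rfl, h0s.le⟩ ⟨h0s.le, le_rfl⟩ h0s.le
  have hΦ0 : Φ 0 = 0 := by simp [hΦ, h0, hP0]
  -- continuity from the left at `t*`: `Φ t* ≤ 0`, i.e. `U t* ≤ P t* < M`
  have hΦcont : ContinuousOn Φ (Icc 0 t₁) := hcont.sub hPcont
  have hlim : Φ tstar ≤ Φ 0 := by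
    have hcw : ContinuousWithinAt Φ (Ico 0 tstar) tstar :=
      (hΦcont tstar htS.1).mono fun s hs => ⟨hs.1, hs.2.le.trans htS.1.2⟩
    have hmem : tstar ∈ closure (Ico 0 tstar) := by
      rw [closure_Ico htpos.ne]; exact ⟨htpos.le, le_rfl⟩
    exact ContinuousWithinAt.closure_le hmem hcw continuousWithinAt_const fun s hs => hanti s hs
  rw [hΦ0] at hlim
  have : U tstar ≤ P tstar := by have h := hlim; simp only [hΦ] at h; linarith
  linarith [hPM tstar htS.1]


omit [DecidableEq d] in
/-- `‖f + g‖³_{L⁹} ≤ 2^{8/3} (‖f‖³_{L⁹} + ‖g‖³_{L⁹})` in integral form: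
`(∫‖f + g‖⁹)^{1/3} ≤ 2^{8/3} ((∫‖f‖⁹)^{1/3} + (∫‖g‖⁹)^{1/3})`. [folklore] -/
private theorem rpow_third_integral_norm_add_pow_nine_le {f g : UnitAddTorus d → EuclideanSpace ℝ d}
    (hf : Continuous f) (hg : Continuous g) :
    (∫ x, ‖f x + g x‖ ^ (9 : ℝ)) ^ (1 / 3 : ℝ) ≤
      (2 : ℝ) ^ (8 / 3 : ℝ) * ((∫ x, ‖f x‖ ^ (9 : ℝ)) ^ (1 / 3 : ℝ) +
        (∫ x, ‖g x‖ ^ (9 : ℝ)) ^ (1 / 3 : ℝ)) := by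
  have hBf0 : 0 ≤ ∫ x, ‖f x‖ ^ (9 : ℝ) := integral_nonneg fun x => Real.rpow_nonneg (norm_nonneg _) _
  have hBg0 : 0 ≤ ∫ x, ‖g x‖ ^ (9 : ℝ) := integral_nonneg fun x => Real.rpow_nonneg (norm_nonneg _) _
  have hB0 : 0 ≤ ∫ x, ‖f x + g x‖ ^ (9 : ℝ) :=
    integral_nonneg fun x => Real.rpow_nonneg (norm_nonneg _) _
  have hpt : ∀ x, ‖f x + g x‖ ^ (9 : ℝ) ≤
      (2 : ℝ) ^ (8 : ℝ) * ‖f x‖ ^ (9 : ℝ) + (2 : ℝ) ^ (8 : ℝ) * ‖g x‖ ^ (9 : ℝ) := by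
    intro x
    have h1 : ‖f x + g x‖ ^ (9 : ℝ) ≤ (‖f x‖ + ‖g x‖) ^ (9 : ℝ) :=
      Real.rpow_le_rpow (norm_nonneg _) (norm_add_le _ _) (by norm_num)
    have h2 := add_rpow_le_two_rpow_mul (norm_nonneg (f x)) (norm_nonneg (g x))
      (by norm_num : (1 : ℝ) ≤ 9)
    rw [show (9 : ℝ) - 1 = 8 by norm_num, mul_add] at h2
    exact h1.trans h2
  have hia : Integrable (fun x => ‖f x‖ ^ (9 : ℝ)) volume :=
    (hf.norm.rpow_const fun x => Or.inr (by norm_num)).integrable_unitAddTorus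
  have hib : Integrable (fun x => ‖g x‖ ^ (9 : ℝ)) volume :=
    (hg.norm.rpow_const fun x => Or.inr (by norm_num)).integrable_unitAddTorus
  have hi1 : Integrable (fun x => ‖f x + g x‖ ^ (9 : ℝ)) volume :=
    ((hf.add hg).norm.rpow_const fun x => Or.inr (by norm_num)).integrable_unitAddTorus
  have hi2 : Integrable (fun x => (2 : ℝ) ^ (8 : ℝ) * ‖f x‖ ^ (9 : ℝ) +
      (2 : ℝ) ^ (8 : ℝ) * ‖g x‖ ^ (9 : ℝ)) volume :=
    (hia.const_mul _).add (hib.const_mul _)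
  have hmono := integral_mono hi1 hi2 hpt
  rw [integral_add (hia.const_mul _) (hib.const_mul _), integral_const_mul,
    integral_const_mul, ← mul_add] at hmono
  have h13 := Real.rpow_le_rpow hB0 hmono (by norm_num : (0 : ℝ) ≤ 1 / 3)
  have h2pos : (0 : ℝ) ≤ (2 : ℝ) ^ (8 : ℝ) := by positivity
  rw [Real.mul_rpow h2pos (add_nonneg hBf0 hBg0), ← Real.rpow_mul (by norm_num : (0 : ℝ) ≤ 2),
    show (8 : ℝ) * (1 / 3) = 8 / 3 by norm_num] at h13
  exact h13.trans (mul_le_mul_of_nonneg_left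
    (add_rpow_le_add_rpow hBf0 hBg0 (by norm_num : (0 : ℝ) ≤ 1 / 3) (by norm_num)) (by positivity))

end HeatFlowCriterion

open HeatFlowCriterion

/-! ## 12. Robinson–Sadowski's Theorem 5 on `T³`, continuation form -/

set_option maxHeartbeats 800000 in
/-- **Robinson–Sadowski 2014, Theorem 5 (the local smoothness criterion via the heat flow of the
datum), continuation form on `T³` with the viscosity restored.** Printed (`ν = 1`, `V = ℝ³` or
`T³`): "There exists an absolute constant `ε > 0` such that if `u₀ ∈ H²` with `∇·u₀ = 0`, and for
some `T > 0`, `‖u₀‖³_{L³} ∫₀ᵀ∫_V |∇v(t)|²|v(t)| dx dt < ε`, where `v(t)` is the solution of the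
heat equation with initial data `u₀`, then `u` is smooth on `(0, T) × V`."

Here, on the unit torus `T^d`, `card d = 3`: there is `ε = ε(d) > 0` such that for every `ν > 0`,
`T > 0`, every classical solution `(u, p)` of the unforced Navier–Stokes equations with viscosity
`ν` on `[0, T) × T^d` with mean-zero velocity slices, and every jointly smooth solution `v` of the
heat equation `∂ₜv = νΔv` on `[0, T) × T^d` with divergence-free mean-zero slices and `v(0) = u(0)`
(i.e. the heat flow `e^{νtΔ}u(0)` of the datum, which has these properties and is unique among
such solutions), the bound
`(∫‖u(0)‖³) · ∫₀ᵗ ∫ ‖v‖ ∑ₖ‖∂ₖv‖² ≤ ε ν⁵` for all `t ∈ [0, T)`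
(the printed smallness of `‖u₀‖³_{L³} ∫₀ᵀ∫|∇v|²|v|`, scaled by `u ↦ ν⁻¹u(·/ν)`) implies that `u`
continues to a classical mean-zero solution on some `[0, T'] × T^d`, `T' > T`, equal to `u` on
`[0, T)` — so no singularity occurs before the time `T` determined by the heat flow of the datum.
Proof = the printed one: `u = v + w`; `‖v(t)‖³_{L³} + 3ν∫₀ᵗ I(v) ≤ ‖u₀‖³_{L³}`
(`heat_integral_norm_cube_add_dissipation_le`); the `L³` inequality (7) of the remainder
(`exists_deriv_remainder_le`); Lemma 4 as a trapping argument (`∫‖w‖³ < mν³` throughout, hence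
`2ν∫₀ᵗ I(w) ≤ K₃ν⁻²‖u₀‖³∫₀ᵗ I(v)`); Lemma 2 turns `∫₀ᵗ(I(v) + I(w))` into a bound on
`∫₀ᵗ ‖u‖³_{L⁹}`, Serrin's condition with `(r, s) = (3, 9)`, and the tree's Serrin continuation
`Torus.classicalNS_continuation_of_Ls_rpow_integral_le`. Deviations from print: classical solutions
with mean-zero slices on the unit torus (print: `u₀ ∈ H²`, `V = ℝ³` or `T³`; Theorem 6 then relaxes
to `u₀ ∈ L³ ∩ L²` by approximation — not restated); the heat flow enters as a hypothesis on `v`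
rather than as the semigroup applied to `u(0)`; `ε = ε(d)` existential (print: absolute,
inexplicit); continuation form of "smooth on `(0, T)`".
[cite: RobinsonSadowski2014, Theorem 5 (pp. 169–171)] -/
theorem Torus.classicalNS_continuation_of_heatFlow_criterion (hd : Fintype.card d = 3) :
    ∃ ε : ℝ, 0 < ε ∧ ∀ {ν T : ℝ}, 0 < ν → 0 < T →
      ∀ {u v : ℝ → UnitAddTorus d → EuclideanSpace ℝ d} {p : ℝ → UnitAddTorus d → ℝ},
        Torus.IsClassicalNSSolutionOn (Ico 0 T) ν 0 u p →
        (∀ t ∈ Ico 0 T, Torus.HasZeroMean (u t)) →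
        Torus.IsSmoothSpaceTimeOn (Ico 0 T) v →
        (∀ t ∈ Ico 0 T, ∀ x, Torus.timeDerivWithin (Ico 0 T) v t x = ν • Torus.laplacian (v t) x) →
        (∀ t ∈ Ico 0 T, Torus.IsDivFree (v t)) → (∀ t ∈ Ico 0 T, Torus.HasZeroMean (v t)) →
        v 0 = u 0 →
        (∀ t ∈ Ico 0 T, (∫ x, ‖u 0 x‖ ^ (3 : ℝ)) *
            ∫ s in (0 : ℝ)..t, ∫ x, ‖v s x‖ * ∑ k, ‖Torus.partialDeriv k (v s) x‖ ^ 2 ≤ ε * ν ^ 5) →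
        ∃ T' : ℝ, T < T' ∧ ∃ (u' : ℝ → UnitAddTorus d → EuclideanSpace ℝ d)
          (p' : ℝ → UnitAddTorus d → ℝ), Torus.IsClassicalNSSolutionOn (Icc 0 T') ν 0 u' p' ∧
            (∀ t ∈ Icc 0 T', Torus.HasZeroMean (u' t)) ∧ ∀ t ∈ Ico 0 T, u' t = u t := by
  obtain ⟨K₁, K₂, K₃, hK₁0, hK₂0, hK₃0, hK⟩ := exists_deriv_remainder_le (d := d) hd
  obtain ⟨c, hc0, hc⟩ := exists_L9_cube_le_weightedDissipation (d := d) hd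
  -- the threshold `M = m ν³` and the smallness constant `ε`
  set m₁ : ℝ := (1 / (4 * (K₁ + 1))) ^ (3 / 2 : ℝ) with hm₁
  set m₂ : ℝ := (1 / (4 * (K₂ + 1))) ^ 3 with hm₂
  have hm₁0 : 0 < m₁ := by rw [hm₁]; positivity
  have hm₂0 : 0 < m₂ := by rw [hm₂]; positivity
  set m : ℝ := min m₁ m₂ with hm
  have hm0 : 0 < m := lt_min hm₁0 hm₂0
  set ε : ℝ := m / (2 * (K₃ + 1)) with hε
  have hε0 : 0 < ε := by rw [hε]; positivity
  refine ⟨ε, hε0, fun {ν T} hν hT {u v p} h hmean hv hheat hdiv hvmean hv0 hsmall => ?_⟩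
  set M : ℝ := m * ν ^ 3 with hM
  have hM0 : 0 < M := by positivity
  -- notation for the four functionals
  set Uw : ℝ → ℝ := fun s => ∫ x, ‖u s x - v s x‖ ^ (3 : ℝ) with hUw
  set Xw : ℝ → ℝ := fun s => ∫ x, ‖u s x - v s x‖ *
    ∑ k, ‖Torus.partialDeriv k (fun y => u s y - v s y) x‖ ^ 2 with hXw
  set Uv : ℝ → ℝ := fun s => ∫ x, ‖v s x‖ ^ (3 : ℝ) with hUv
  set Xv : ℝ → ℝ := fun s => ∫ x, ‖v s x‖ * ∑ k, ‖Torus.partialDeriv k (v s) x‖ ^ 2 with hXv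
  set U₀ : ℝ := ∫ x, ‖u 0 x‖ ^ (3 : ℝ) with hU₀
  have hUwnn : ∀ s, 0 ≤ Uw s := fun s => integral_nonneg fun x => Real.rpow_nonneg (norm_nonneg _) _
  have hXwnn : ∀ s, 0 ≤ Xw s := fun s => integral_nonneg fun x =>
    mul_nonneg (norm_nonneg _) (Finset.sum_nonneg fun k _ => sq_nonneg _)
  have hUvnn : ∀ s, 0 ≤ Uv s := fun s => integral_nonneg fun x => Real.rpow_nonneg (norm_nonneg _) _
  have hXvnn : ∀ s, 0 ≤ Xv s := fun s => integral_nonneg fun x =>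
    mul_nonneg (norm_nonneg _) (Finset.sum_nonneg fun k _ => sq_nonneg _)
  have hU₀nn : 0 ≤ U₀ := integral_nonneg fun x => Real.rpow_nonneg (norm_nonneg _) _
  have hUw0 : Uw 0 = 0 := by
    simp only [hUw, hv0, sub_self, norm_zero, Real.zero_rpow (by norm_num : (3 : ℝ) ≠ 0),
      integral_zero]
  have hUv0 : Uv 0 = U₀ := by simp only [hUv, hU₀, hv0]
  -- ### the closed inequality below the threshold
  have hcubic : ∀ {y : ℝ}, 0 ≤ y → y < M →
      K₁ * ν⁻¹ * y ^ (2 / 3 : ℝ) ≤ ν / 4 ∧ K₂ * y ^ (1 / 3 : ℝ) ≤ ν / 4 := by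
    intro y hy hyM
    have hmν : M = m * ν ^ 3 := rfl
    constructor
    · -- `y^{2/3} ≤ (m₁ ν³)^{2/3} = ν²/(4(K₁+1))`
      have h1 : y ^ (2 / 3 : ℝ) ≤ (m₁ * ν ^ 3) ^ (2 / 3 : ℝ) :=
        Real.rpow_le_rpow hy (hyM.le.trans (by
          rw [hmν]; exact mul_le_mul_of_nonneg_right (min_le_left _ _) (by positivity)))
          (by norm_num)
      have e1 : (m₁ * ν ^ 3) ^ (2 / 3 : ℝ) = 1 / (4 * (K₁ + 1)) * ν ^ 2 := by
        rw [Real.mul_rpow hm₁0.le (by positivity), hm₁, ← Real.rpow_mul (by positivity),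
          ← Real.rpow_natCast ν 3, ← Real.rpow_mul hν.le]
        norm_num
      rw [e1] at h1
      have hK₁' : K₁ / (K₁ + 1) ≤ 1 := (div_le_one (by linarith)).2 (by linarith)
      calc K₁ * ν⁻¹ * y ^ (2 / 3 : ℝ) ≤ K₁ * ν⁻¹ * (1 / (4 * (K₁ + 1)) * ν ^ 2) :=
            mul_le_mul_of_nonneg_left h1 (mul_nonneg hK₁0 (inv_nonneg.2 hν.le))
        _ = K₁ / (K₁ + 1) * (ν / 4) := by field_simp
        _ ≤ 1 * (ν / 4) := mul_le_mul_of_nonneg_right hK₁' (by positivity)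
        _ = ν / 4 := one_mul _
    · have h1 : y ^ (1 / 3 : ℝ) ≤ (m₂ * ν ^ 3) ^ (1 / 3 : ℝ) :=
        Real.rpow_le_rpow hy (hyM.le.trans (by
          rw [hmν]; exact mul_le_mul_of_nonneg_right (min_le_right _ _) (by positivity)))
          (by norm_num)
      have e1 : (m₂ * ν ^ 3) ^ (1 / 3 : ℝ) = 1 / (4 * (K₂ + 1)) * ν := by
        rw [Real.mul_rpow hm₂0.le (by positivity), hm₂, ← Real.rpow_natCast _ 3,
          ← Real.rpow_mul (by positivity), ← Real.rpow_natCast ν 3, ← Real.rpow_mul hν.le]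
        norm_num
      rw [e1] at h1
      have hK₂' : K₂ / (K₂ + 1) ≤ 1 := (div_le_one (by linarith)).2 (by linarith)
      calc K₂ * y ^ (1 / 3 : ℝ) ≤ K₂ * (1 / (4 * (K₂ + 1)) * ν) :=
            mul_le_mul_of_nonneg_left h1 hK₂0
        _ = K₂ / (K₂ + 1) * (ν / 4) := by field_simp
        _ ≤ 1 * (ν / 4) := mul_le_mul_of_nonneg_right hK₂' (by positivity)
        _ = ν / 4 := one_mul _
  -- the heat solution as a classical forced NS solution on `[0, T)`
  have hvNS := isClassicalNS_of_heat hv hheat hdiv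
  -- ### on every closed window `[0, t₁] ⊆ [0, T)`
  have hwindow : ∀ t₁ ∈ Ico 0 T, 0 < t₁ →
      2 * ν * (∫ s in (0 : ℝ)..t₁, Xw s) ≤ M ∧ 3 * ν * (∫ s in (0 : ℝ)..t₁, Xv s) ≤ U₀ := by
    intro t₁ ht₁ h0t₁
    have hsub : Icc 0 t₁ ⊆ Ico 0 T := fun s hs => ⟨hs.1, hs.2.trans_lt ht₁.2⟩
    have hU1 : UniqueDiffOn ℝ (Icc 0 t₁) := uniqueDiffOn_Icc h0t₁
    have h' : Torus.IsClassicalNSSolutionOn (Icc 0 t₁) ν 0 u p := h.mono hsub hU1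
    have hv' : Torus.IsSmoothSpaceTimeOn (Icc 0 t₁) v := hv.mono hsub
    have hheat' := heat_mono hv hheat hsub hU1
    have hdiv' : ∀ t ∈ Icc 0 t₁, Torus.IsDivFree (v t) := fun t ht => hdiv t (hsub ht)
    have hvmean' : ∀ t ∈ Icc 0 t₁, Torus.HasZeroMean (v t) := fun t ht => hvmean t (hsub ht)
    have hmean' : ∀ t ∈ Icc 0 t₁, Torus.HasZeroMean (u t) := fun t ht => hmean t (hsub ht)
    -- the heat part
    have hheatpart : ∀ s ∈ Icc 0 t₁, Uv s + 3 * ν * (∫ r in (0 : ℝ)..s, Xv r) ≤ U₀ := by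
      intro s hs
      have := heat_integral_norm_cube_add_dissipation_le hν h0t₁ hv' hheat' hdiv' hs
      rw [← hUv0]
      exact this
    -- derivatives of `Uw` within `[0, t₁]`
    have hzst : Torus.IsSmoothSpaceTimeOn (Icc 0 t₁) (fun s x => u s x - v s x) :=
      h'.smooth_velocity.sub hv'
    have hder : ∀ s ∈ Icc 0 t₁, ∃ R, HasDerivWithinAt Uw R (Icc 0 t₁) s := fun s hs =>
      hasDerivWithinAt_integral_norm_rpow hzst h0t₁ (by norm_num) hs
    choose! Ud hUd using hder
    have hineq : ∀ s ∈ Icc 0 t₁, Ud s ≤ -(5 / 2 * ν * Xw s) + K₁ * ν⁻¹ * Uw s ^ (2 / 3 : ℝ) * Xw s +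
        K₂ * Uw s ^ (1 / 3 : ℝ) * Xw s + K₃ * ν⁻¹ ^ 2 * Uv s * Xv s := fun s hs =>
      hK hν h0t₁ h' hmean' hv' hheat' hdiv' hvmean' s hs (Ud s) (hUd s hs)
    -- the forcing `G = K₃ ν⁻² U₀ Xv` and its primitive `P`
    have hXvc : ContinuousOn Xv (Icc 0 t₁) := continuousOn_weightedDissipation h0t₁ hv'
    have hXwc : ContinuousOn Xw (Icc 0 t₁) := continuousOn_weightedDissipation h0t₁ hzst
    set G : ℝ → ℝ := fun s => K₃ * ν⁻¹ ^ 2 * U₀ * Xv s with hG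
    set P : ℝ → ℝ := fun s => ∫ r in (0 : ℝ)..s, G r with hP
    have hGc : ContinuousOn G (Icc 0 t₁) := continuousOn_const.mul hXvc
    have hPd : ∀ s ∈ Icc 0 t₁, HasDerivWithinAt P (G s) (Icc 0 t₁) s := by
      intro s hs
      haveI : Fact (s ∈ Icc 0 t₁) := ⟨hs⟩
      have hint : IntervalIntegrable G volume 0 s :=
        (hGc.mono (Icc_subset_Icc_right hs.2)).intervalIntegrable_of_Icc hs.1
      exact intervalIntegral.integral_hasDerivWithinAt_right hint
        (hGc.stronglyMeasurableAtFilter_nhdsWithin measurableSet_Icc s) (hGc s hs)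
    have hP0 : P 0 = 0 := by simp [hP]
    have hPval : ∀ s ∈ Icc 0 t₁, P s = K₃ * ν⁻¹ ^ 2 * U₀ * ∫ r in (0 : ℝ)..s, Xv r := by
      intro s hs
      simp only [hP, hG]
      exact intervalIntegral.integral_const_mul _ _
    have hPM : ∀ s ∈ Icc 0 t₁, P s < M := by
      intro s hs
      rw [hPval s hs]
      have hsm := hsmall s (hsub hs)
      -- `K₃ ν⁻² (U₀ ∫ Xv) ≤ K₃ ν⁻² ε ν⁵ = K₃ ε ν³ < m ν³`
      have h1 : K₃ * ν⁻¹ ^ 2 * U₀ * (∫ r in (0 : ℝ)..s, Xv r) ≤ K₃ * ν⁻¹ ^ 2 * (ε * ν ^ 5) := by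
        have := mul_le_mul_of_nonneg_left hsm (by positivity : (0 : ℝ) ≤ K₃ * ν⁻¹ ^ 2)
        linarith [this]
      have h2 : K₃ * ν⁻¹ ^ 2 * (ε * ν ^ 5) = K₃ / (K₃ + 1) * (m / 2) * ν ^ 3 := by
        rw [hε]; field_simp
      have hK₃' : K₃ / (K₃ + 1) ≤ 1 := (div_le_one (by linarith)).2 (by linarith)
      have h3 : K₃ / (K₃ + 1) * (m / 2) * ν ^ 3 ≤ 1 * (m / 2) * ν ^ 3 := by gcongr
      have h4 : 1 * (m / 2) * ν ^ 3 < M := by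
        rw [hM]; have : 0 < m * ν ^ 3 := by positivity
        linarith
      linarith
    have hle : ∀ s ∈ Icc 0 t₁, Uw s < M → Ud s ≤ G s := by
      intro s hs hsM
      obtain ⟨hc1, hc2⟩ := hcubic (hUwnn s) hsM
      have hX0 := hXwnn s
      have hUvle : Uv s ≤ U₀ := by
        have := hheatpart s hs
        have h0 : 0 ≤ ∫ r in (0 : ℝ)..s, Xv r :=
          intervalIntegral.integral_nonneg hs.1 fun r hr => hXvnn r
        nlinarith [hν.le]
      have h5 : K₃ * ν⁻¹ ^ 2 * Uv s * Xv s ≤ G s := by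
        simp only [hG]
        have : 0 ≤ K₃ * ν⁻¹ ^ 2 := by positivity
        have := mul_le_mul_of_nonneg_left hUvle this
        exact mul_le_mul_of_nonneg_right this (hXvnn s)
      have h6 : K₁ * ν⁻¹ * Uw s ^ (2 / 3 : ℝ) * Xw s ≤ ν / 4 * Xw s :=
        mul_le_mul_of_nonneg_right hc1 hX0
      have h7 : K₂ * Uw s ^ (1 / 3 : ℝ) * Xw s ≤ ν / 4 * Xw s :=
        mul_le_mul_of_nonneg_right hc2 hX0
      have := hineq s hs
      nlinarith [hν.le]
    -- trapping: `Uw < M` on `[0, t₁]`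
    have hlt : ∀ s ∈ Icc 0 t₁, Uw s < M :=
      lt_of_deriv_le_forcing_below hUd hPd hUw0 hP0 hPM hle
    -- hence `Ud ≤ -2ν Xw + G` everywhere, and `Φ = Uw + 2ν∫Xw − P` is non-increasing
    have hUd_le : ∀ s ∈ Icc 0 t₁, Ud s ≤ -(2 * ν * Xw s) + G s := by
      intro s hs
      obtain ⟨hc1, hc2⟩ := hcubic (hUwnn s) (hlt s hs)
      have hX0 := hXwnn s
      have hUvle : Uv s ≤ U₀ := by
        have := hheatpart s hs
        have h0 : 0 ≤ ∫ r in (0 : ℝ)..s, Xv r :=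
          intervalIntegral.integral_nonneg hs.1 fun r hr => hXvnn r
        nlinarith [hν.le]
      have h5 : K₃ * ν⁻¹ ^ 2 * Uv s * Xv s ≤ G s := by
        simp only [hG]
        have : 0 ≤ K₃ * ν⁻¹ ^ 2 := by positivity
        have := mul_le_mul_of_nonneg_left hUvle this
        exact mul_le_mul_of_nonneg_right this (hXvnn s)
      have h6 : K₁ * ν⁻¹ * Uw s ^ (2 / 3 : ℝ) * Xw s ≤ ν / 4 * Xw s :=
        mul_le_mul_of_nonneg_right hc1 hX0
      have h7 : K₂ * Uw s ^ (1 / 3 : ℝ) * Xw s ≤ ν / 4 * Xw s :=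
        mul_le_mul_of_nonneg_right hc2 hX0
      have := hineq s hs
      nlinarith [hν.le]
    set Pr : ℝ → ℝ := fun s => ∫ r in (0 : ℝ)..s, Xw r with hPr
    have hPrd : ∀ s ∈ Icc 0 t₁, HasDerivWithinAt Pr (Xw s) (Icc 0 t₁) s := by
      intro s hs
      haveI : Fact (s ∈ Icc 0 t₁) := ⟨hs⟩
      have hint : IntervalIntegrable Xw volume 0 s :=
        (hXwc.mono (Icc_subset_Icc_right hs.2)).intervalIntegrable_of_Icc hs.1
      exact intervalIntegral.integral_hasDerivWithinAt_right hint
        (hXwc.stronglyMeasurableAtFilter_nhdsWithin measurableSet_Icc s) (hXwc s hs)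
    set Φ : ℝ → ℝ := fun s => Uw s + 2 * ν * Pr s - P s with hΦ
    have hΦd : ∀ s ∈ Icc 0 t₁, HasDerivWithinAt Φ (Ud s + 2 * ν * Xw s - G s) (Icc 0 t₁) s :=
      fun s hs => ((hUd s hs).add ((hPrd s hs).const_mul _)).sub (hPd s hs)
    have hΦanti : AntitoneOn Φ (Icc 0 t₁) :=
      antitoneOn_of_hasDerivWithinAt_nonpos (convex_Icc 0 t₁)
        (fun s hs => (hΦd s hs).continuousWithinAt)
        (fun s hs => (hΦd s (interior_subset hs)).mono interior_subset)
        (fun s hs => by linarith [hUd_le s (interior_subset hs)])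
    have hΦ0 : Φ 0 = 0 := by simp [hΦ, hPr, hUw0, hP0]
    have h1 := hΦanti ⟨le_rfl, h0t₁.le⟩ ⟨h0t₁.le, le_rfl⟩ h0t₁.le
    rw [hΦ0] at h1
    have h1' : Uw t₁ + 2 * ν * Pr t₁ - P t₁ ≤ 0 := h1
    refine ⟨?_, ?_⟩
    · have := hPM t₁ ⟨h0t₁.le, le_rfl⟩
      have hU1 := hUwnn t₁
      have : Uw t₁ + 2 * ν * (∫ s in (0 : ℝ)..t₁, Xw s) - P t₁ ≤ 0 := by simpa only [hPr] using h1'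
      linarith
    · have := hheatpart t₁ ⟨h0t₁.le, le_rfl⟩
      linarith [hUvnn t₁]
  -- ### Serrin's condition with `(r, s) = (3, 9)`
  have hs9 : (3 : ℝ) < 9 := by norm_num
  set N : ℝ → ℝ := fun t => (∫ x, ‖u t x‖ ^ (9 : ℝ)) ^ (1 / 9 : ℝ) with hN
  have hB0 : ∀ t, 0 ≤ ∫ x, ‖u t x‖ ^ (9 : ℝ) := fun t =>
    integral_nonneg fun x => Real.rpow_nonneg (norm_nonneg _) _
  have hNc : ContinuousOn N (Ico 0 T) :=
    (continuousOn_integral_norm_rpow h.smooth_velocity (by norm_num : (0 : ℝ) ≤ 9)).rpow_const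
      fun t _ => Or.inr (by norm_num)
  have hN0 : ∀ t ∈ Ico 0 T, 0 ≤ N t := fun t _ => Real.rpow_nonneg (hB0 t) _
  -- `N³ = (∫‖u‖⁹)^{1/3} ≤ 2^{8/3} c (Xv + Xw)`
  have hNpow : ∀ t ∈ Ico 0 T, N t ^ (2 * (9 : ℝ) / (9 - 3)) ≤ (2 : ℝ) ^ (8 / 3 : ℝ) * c * (Xv t + Xw t) := by
    intro t ht
    have hut : Torus.IsSmooth (u t) := h.smooth_velocity.isSmooth_slice ht
    have hvt : Torus.IsSmooth (v t) := hv.isSmooth_slice ht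
    have hwt : Torus.IsSmooth (fun y => u t y - v t y) := hut.sub hvt
    have hw0 : Torus.HasZeroMean (fun y => u t y - v t y) :=
      hasZeroMean_sub hut.continuous hvt.continuous (hmean t ht) (hvmean t ht)
    have hLv : (∫ x, ‖v t x‖ ^ (9 : ℝ)) ^ (1 / 3 : ℝ) ≤ c * Xv t := hc (v t) hvt (hvmean t ht)
    have hLw : (∫ x, ‖u t x - v t x‖ ^ (9 : ℝ)) ^ (1 / 3 : ℝ) ≤ c * Xw t := hc _ hwt hw0
    have e : N t ^ (2 * (9 : ℝ) / (9 - 3)) = (∫ x, ‖u t x‖ ^ (9 : ℝ)) ^ (1 / 3 : ℝ) := by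
      rw [hN]
      simp only
      rw [← Real.rpow_mul (hB0 t)]
      norm_num
    rw [e]
    have hsplit := rpow_third_integral_norm_add_pow_nine_le hvt.continuous hwt.continuous
    have e2 : (fun x => ‖v t x + (u t x - v t x)‖ ^ (9 : ℝ)) = fun x => ‖u t x‖ ^ (9 : ℝ) := by
      funext x; rw [add_sub_cancel]
    rw [e2] at hsplit
    calc (∫ x, ‖u t x‖ ^ (9 : ℝ)) ^ (1 / 3 : ℝ)
        ≤ (2 : ℝ) ^ (8 / 3 : ℝ) * ((∫ x, ‖v t x‖ ^ (9 : ℝ)) ^ (1 / 3 : ℝ) +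
            (∫ x, ‖u t x - v t x‖ ^ (9 : ℝ)) ^ (1 / 3 : ℝ)) := hsplit
      _ ≤ (2 : ℝ) ^ (8 / 3 : ℝ) * (c * Xv t + c * Xw t) := by gcongr
      _ = (2 : ℝ) ^ (8 / 3 : ℝ) * c * (Xv t + Xw t) := by ring
  set I : ℝ := (2 : ℝ) ^ (8 / 3 : ℝ) * c * (U₀ / (3 * ν) + M / (2 * ν)) with hI
  refine Torus.classicalNS_continuation_of_Ls_rpow_integral_le hd hν hT hs9 h hmean hNc hN0
    (fun t ht => le_rfl) (I := I) fun t ht => ?_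
  rcases ht.1.eq_or_lt with h0 | h0t
  · rw [← h0, intervalIntegral.integral_same, hI]
    positivity
  · have hsub : Icc 0 t ⊆ Ico 0 T := fun s hs => ⟨hs.1, hs.2.trans_lt ht.2⟩
    have h' : Torus.IsClassicalNSSolutionOn (Icc 0 t) ν 0 u p := h.mono hsub (uniqueDiffOn_Icc h0t)
    have hv' : Torus.IsSmoothSpaceTimeOn (Icc 0 t) v := hv.mono hsub
    have hzst : Torus.IsSmoothSpaceTimeOn (Icc 0 t) (fun s x => u s x - v s x) :=
      h'.smooth_velocity.sub hv'
    have hXvc : ContinuousOn Xv (Icc 0 t) := continuousOn_weightedDissipation h0t hv'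
    have hXwc : ContinuousOn Xw (Icc 0 t) := continuousOn_weightedDissipation h0t hzst
    have hNc' : ContinuousOn (fun s => N s ^ (2 * (9 : ℝ) / (9 - 3))) (Icc 0 t) :=
      (hNc.mono hsub).rpow_const fun s _ => Or.inr (by norm_num)
    have hmono : ∫ s in (0 : ℝ)..t, N s ^ (2 * (9 : ℝ) / (9 - 3)) ≤
        ∫ s in (0 : ℝ)..t, (2 : ℝ) ^ (8 / 3 : ℝ) * c * (Xv s + Xw s) :=
      intervalIntegral.integral_mono_on h0t.le (hNc'.intervalIntegrable_of_Icc h0t.le)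
        ((continuousOn_const.mul (hXvc.add hXwc)).intervalIntegrable_of_Icc h0t.le)
        fun s hs => hNpow s (hsub hs)
    have hXvi : IntervalIntegrable Xv volume 0 t := hXvc.intervalIntegrable_of_Icc h0t.le
    have hXwi : IntervalIntegrable Xw volume 0 t := hXwc.intervalIntegrable_of_Icc h0t.le
    obtain ⟨hW, hV⟩ := hwindow t ht h0t
    have hXw_int : ∫ s in (0 : ℝ)..t, Xw s ≤ M / (2 * ν) := by
      rw [le_div_iff₀ (by positivity)]; linarith
    have hXv_int : ∫ s in (0 : ℝ)..t, Xv s ≤ U₀ / (3 * ν) := by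
      rw [le_div_iff₀ (by positivity)]; linarith
    calc ∫ s in (0 : ℝ)..t, N s ^ (2 * (9 : ℝ) / (9 - 3))
        ≤ ∫ s in (0 : ℝ)..t, (2 : ℝ) ^ (8 / 3 : ℝ) * c * (Xv s + Xw s) := hmono
      _ = (2 : ℝ) ^ (8 / 3 : ℝ) * c * ((∫ s in (0 : ℝ)..t, Xv s) + ∫ s in (0 : ℝ)..t, Xw s) := by
          rw [intervalIntegral.integral_const_mul, intervalIntegral.integral_add hXvi hXwi]
      _ ≤ (2 : ℝ) ^ (8 / 3 : ℝ) * c * (U₀ / (3 * ν) + M / (2 * ν)) := by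
          gcongr
      _ = I := rfl

end Literature.Analysis.FluidPDE
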